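import Literature.NumberTheory.NumberFields.SqrtTwoTowerThreeOrderFourClassCertificate
import Literature.NumberTheory.IwasawaTheory.ClassGroupLayerTwoOrderFourOfTowerCertificate
import Literature.NumberTheory.IwasawaTheory.ClassicalMuVanishesLayerTwoUnitCertificateTwo
import HarnessLib

/-!
# A CLASS OF ORDER `4` IN `Cl(K_3)` FROM THE BASE FIELD: the third layer `K_3 = K·ℚ(ζ₃₂)⁺ = K(√2, √(2+√2), √(2+√(2+√2)))` of the cyclotomic
# `ℤ₂`-extension of an odd-degree field `K` (`2 ∤ d_K`) has an ideal class of order `4` as soon as a THREE-STEP TOWER ORDER-FOUR CERTIFICATE written in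
# `𝓞_K` (eight coordinates) is supplied; hence (att-p3 g47's elementary-layer door at `k = 3`) `μ₂ = 0`, `λ₂ ≤ 6` when moreover `2 ∤ h_K` and `e₁ ≤ 1`

`Proofs`-style file (theorems only: no definition, no named fact, no instance, no `sorry`) in topic `NumberTheory/IwasawaTheory` (namespace = path),
written by the prover seat `bsd-line-att-p4` g41 (cell `bsd-f1-sign2`, route `AlignedTransportAtTwo`; `--supports` stmt-BirchSwinnertonDyer-22298, closes
nothing).  The `ℤ₂`-tower packaging of this seat's `NumberFields/SqrtTwoTowerThreeOrderFourClassCertificate`, one layer above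
`ClassGroupLayerTwoOrderFourOfTowerCertificate`: every datum about the abstract layer `K_3` is an IDENTITY IN `𝓞_K` between coordinates on the basis
`1, s₁, s₂, s₁s₂, s₃, s₁s₃, s₂s₃, s₁s₂s₃` (`s₁² = 2`, `s₂² = 2 + s₁`, `s₃² = 2 + s₂`).

* ★★ `exists_orderOf_eq_four_layer_three_of_tower3Cert` — `K` with `2 ∤ [K:ℚ]`, `2 ∤ d_K`, `8·#Pl_∞(K) ≤ n + 1`, `κ` cyclotomic; coordinates of `n` units of
  `K_3` with inverses, of `w`, `w*` (`q₀⁴ = w·w*`), Bézout `μw + νw* = 1`, `q₀ ≠ 0`, `v`, `V = v²` and witnesses for `(q₀, v)² = (w, q₀²)`, and the residue certificates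
  (existential form; supplied in practice by `NumberFields.tower3Cert_of_charMatrix`) ⟹ **`∃ c ∈ Cl(K_3)`, `orderOf c = 4`**.
* ★★★ `classicalMuVanishes_two_of_layer_three_tower3Cert` — if moreover `2 ∤ h_K` and `e₁ ≤ 1`: **`rank₂ Cl(K_m) ≤ 6 ∀ m`, `μ₂ = 0`, `λ₂ ≤ 6`**
  (att-p3 g47's `classicalMuVanishes_two_of_orderOf_eq_four_of_not_dvd_discr` at `k = 3`).

CELL READING (crux C2, u7 sub-cell, HARD CORE `t = 3 ∧ e₁ = 1`, seeds `N = 1259, 3523, 14891`, where `Cl(K_2)[2^∞] ≅ (ℤ/2)³` and every layer-`≤ 2` door is silent):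
this is the KERNEL HALF of the layer-three lever; the DATA HALF (15 units of the degree-24 field `K_3`, an ideal of order `4` with a generator of its fourth power,
17 residue characters) is a data-seat computation (`bnfinit`-size, GRH-free once found since every datum is re-verified here).  Nothing about any seed is asserted;
BSD is not advanced by this file.

References: [NeukirchANT1999] Ch. I §2, §3, §7 Thm. (7.4), §8; [Cohen1993] §6.5; [Washington1997] §13.1 (`K_3 = K·ℚ(ζ₃₂)⁺`), §13.3;
[Serre1973CourseArithmetic] Ch. I §3; [Marcus2018] Ch. 3 Thm. 27.
-/

set_option autoImplicit false

noncomputable section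

open scoped NumberField nonZeroDivisors
open NumberField IsDedekindDomain Module

namespace Literature.NumberTheory.IwasawaTheory

open Literature.NumberTheory.EllipticCurves Literature.NumberTheory.NumberFields

variable {K : Type} [Field K] [NumberField K]

/-! ## §0 Pure algebra: the coordinate calculus in any commutative ring `R ∋ S₁, S₂, S₃` with `S₁² = 2`, `S₂² = 2 + S₁`, `S₃² = 2 + S₂` -/

section Algebra

variable {O R : Type*} [CommRing O] [CommRing R] (f : O →+* R) {S₁ S₂ S₃ : R}

/-- **The product rule on `f`-images of eight coordinates** (`S₁² = 2`, `S₂² = 2 + S₁`, `S₃² = 2 + S₂`). [folklore] -/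
private theorem tower3_coordMul (hS₁ : S₁ ^ 2 = 2) (hS₂ : S₂ ^ 2 = 2 + S₁) (hS₃ : S₃ ^ 2 = 2 + S₂) (x₀ x₁ x₂ x₃ x₄ x₅ x₆ x₇ y₀ y₁ y₂ y₃ y₄ y₅ y₆ y₇ : O) :
    (f x₀ + f x₁ * S₁ + (f x₂ + f x₃ * S₁) * S₂ + (f x₄ + f x₅ * S₁ + (f x₆ + f x₇ * S₁) * S₂) * S₃) * (f y₀ + f y₁ * S₁ + (f y₂ + f y₃ * S₁) * S₂ + (f y₄ + f y₅ * S₁ + (f y₆ + f y₇ * S₁) * S₂) * S₃) =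
      f (x₀ * y₀ + 2 * x₁ * y₁ + 2 * x₂ * y₂ + 2 * x₂ * y₃ + 2 * x₃ * y₂ + 4 * x₃ * y₃ + 2 * x₄ * y₄ + 2 * x₄ * y₆ + 2 * x₄ * y₇ + 4 * x₅ * y₅ + 2 * x₅ * y₆ + 4 * x₅ * y₇ + 2 * x₆ * y₄ + 2 * x₆ * y₅ + 4 * x₆ * y₆ + 4 * x₆ * y₇ + 2 * x₇ * y₄ + 4 * x₇ * y₅ + 4 * x₇ * y₆ + 8 * x₇ * y₇) + f (x₀ * y₁ + x₁ * y₀ + x₂ * y₂ + 2 * x₂ * y₃ + 2 * x₃ * y₂ + 2 * x₃ * y₃ + 2 * x₄ * y₅ + x₄ * y₆ + 2 * x₄ * y₇ + 2 * x₅ * y₄ + 2 * x₅ * y₆ + 2 * x₅ * y₇ + x₆ * y₄ + 2 * x₆ * y₅ + 2 * x₆ * y₆ + 4 * x₆ * y₇ + 2 * x₇ * y₄ + 2 * x₇ * y₅ + 4 * x₇ * y₆ + 4 * x₇ * y₇) * S₁ + (f (x₀ * y₂ + 2 * x₁ * y₃ + x₂ * y₀ + 2 * x₃ * y₁ + x₄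 * y₄ + 2 * x₄ * y₆ + 2 * x₅ * y₅ + 4 * x₅ * y₇ + 2 * x₆ * y₄ + 2 * x₆ * y₆ + 2 * x₆ * y₇ + 4 * x₇ * y₅ + 2 * x₇ * y₆ + 4 * x₇ * y₇) + f (x₀ * y₃ + x₁ * y₂ + x₂ * y₁ + x₃ * y₀ + x₄ * y₅ + 2 * x₄ * y₇ + x₅ * y₄ + 2 * x₅ * y₆ + 2 * x₆ * y₅ + x₆ * y₆ + 2 * x₆ * y₇ + 2 * x₇ * y₄ + 2 * x₇ * y₆ + 2 * x₇ * y₇) * S₁) * S₂ + (f (x₀ * y₄ + 2 * x₁ * y₅ + 2 * x₂ * y₆ + 2 * x₂ * y₇ + 2 * x₃ * y₆ + 4 * x₃ * y₇ + x₄ * y₀ + 2 * x₅ * y₁ + 2 * x₆ * y₂ + 2 * x₆ * y₃ + 2 * x₇ * y₂ + 4 * x₇ * y₃) + f (x₀ * y₅ + x₁ * y₄ + x₂ * y₆ + 2 * x₂ * y₇ + 2 * x₃ * y₆ + 2 * x₃ * y₇ + x₄ * y₁ + x₅ * y₀ + x₆ * y₂ + 2 * x₆ * y₃ + 2 * x₇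 * y₂ + 2 * x₇ * y₃) * S₁ + (f (x₀ * y₆ + 2 * x₁ * y₇ + x₂ * y₄ + 2 * x₃ * y₅ + x₄ * y₂ + 2 * x₅ * y₃ + x₆ * y₀ + 2 * x₇ * y₁) + f (x₀ * y₇ + x₁ * y₆ + x₂ * y₅ + x₃ * y₄ + x₄ * y₃ + x₅ * y₂ + x₆ * y₁ + x₇ * y₀) * S₁) * S₂) * S₃ := by
  simp only [map_add, map_mul, map_ofNat]
  linear_combination (f x₁ * f y₁ + f x₂ * f y₃ + f x₃ * f y₂ + 2 * f x₃ * f y₃ + f x₄ * f y₇ + 2 * f x₅ * f y₅ + f x₅ * f y₆ + 2 * f x₅ * f y₇ + f x₆ * f y₅ + 2 * f x₆ * f y₇ + f x₇ * f y₄ + 2 * f x₇ * f y₅ + 2 * f x₇ * f y₆ + 4 * f x₇ * f y₇ + S₁ * f x₃ * f y₃ + S₁ * f x₅ * f y₇ + S₁ * f x₇ * f y₅ + 2 * S₁ * f x₇ * f y₇ + S₂ * f x₁ * f y₃ + S₂ * f x₃ * f y₁ + S₂ * f x₅ * f y₅ + 2 * S₂ * f x₅ * f y₇ + S₂ * f x₆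 * f y₇ + 2 * S₂ * f x₇ * f y₅ + S₂ * f x₇ * f y₆ + 2 * S₂ * f x₇ * f y₇ + S₃ * f x₁ * f y₅ + S₃ * f x₂ * f y₇ + S₃ * f x₃ * f y₆ + 2 * S₃ * f x₃ * f y₇ + S₃ * f x₅ * f y₁ + S₃ * f x₆ * f y₃ + S₃ * f x₇ * f y₂ + 2 * S₃ * f x₇ * f y₃ + S₁ * S₂ * f x₇ * f y₇ + S₁ * S₃ * f x₃ * f y₇ + S₁ * S₃ * f x₇ * f y₃ + S₂ * S₃ * f x₁ * f y₇ + S₂ * S₃ * f x₃ * f y₅ + S₂ * S₃ * f x₅ * f y₃ + S₂ * S₃ * f x₇ * f y₁) * hS₁ +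
    (f x₂ * f y₂ + f x₄ * f y₆ + f x₆ * f y₄ + 2 * f x₆ * f y₆ + S₁ * f x₂ * f y₃ + S₁ * f x₃ * f y₂ + S₁ * f x₄ * f y₇ + S₁ * f x₅ * f y₆ + S₁ * f x₆ * f y₅ + 2 * S₁ * f x₆ * f y₇ + S₁ * f x₇ * f y₄ + 2 * S₁ * f x₇ * f y₆ + S₁ * S₁ * f x₃ * f y₃ + S₁ * S₁ * f x₅ * f y₇ + S₁ * S₁ * f x₇ * f y₅ + 2 * S₁ * S₁ * f x₇ * f y₇ + S₂ * f x₆ * f y₆ + S₃ * f x₂ * f y₆ + S₃ * f x₆ * f y₂ + S₁ * S₂ * f x₆ * f y₇ + S₁ * S₂ * f x₇ * f y₆ + S₁ * S₃ * f x₂ * f y₇ + S₁ * S₃ * f x₃ * f y₆ + S₁ * S₃ * f x₆ * f y₃ + S₁ * S₃ * f x₇ * f y₂ + S₁ * S₁ * S₂ * f x₇ * f y₇ + S₁ * S₁ * S₃ * f x₃ * f y₇ + S₁ * S₁ * S₃ * f x₇ * f y₃) * hS₂ +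
    (f x₄ * f y₄ + S₁ * f x₄ * f y₅ + S₁ * f x₅ * f y₄ + S₁ * S₁ * f x₅ * f y₅ + S₂ * f x₄ * f y₆ + S₂ * f x₆ * f y₄ + S₂ * S₂ * f x₆ * f y₆ + S₁ * S₂ * f x₄ * f y₇ + S₁ * S₂ * f x₅ * f y₆ + S₁ * S₂ * f x₆ * f y₅ + S₁ * S₂ * f x₇ * f y₄ + S₁ * S₂ * S₂ * f x₆ * f y₇ + S₁ * S₂ * S₂ * f x₇ * f y₆ + S₁ * S₁ * S₂ * f x₅ * f y₇ + S₁ * S₁ * S₂ * f x₇ * f y₅ + S₁ * S₁ * S₂ * S₂ * f x₇ * f y₇) * hS₃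

/-- **A unit from coordinates**: `P(a, c) = (1, 0, …, 0)` in `O` ⟹ `E(a)·E(c) = 1` in `R`. [folklore] -/
private theorem tower3_mul_eq_one_of_coords (hS₁ : S₁ ^ 2 = 2) (hS₂ : S₂ ^ 2 = 2 + S₁) (hS₃ : S₃ ^ 2 = 2 + S₂) {x₀ x₁ x₂ x₃ x₄ x₅ x₆ x₇ y₀ y₁ y₂ y₃ y₄ y₅ y₆ y₇ : O}
    (h : x₀ * y₀ + 2 * x₁ * y₁ + 2 * x₂ * y₂ + 2 * x₂ * y₃ + 2 * x₃ * y₂ + 4 * x₃ * y₃ + 2 * x₄ * y₄ + 2 * x₄ * y₆ + 2 * x₄ * y₇ + 4 * x₅ * y₅ + 2 * x₅ * y₆ + 4 * x₅ * y₇ + 2 * x₆ * y₄ + 2 * x₆ * y₅ + 4 * x₆ * y₆ + 4 * x₆ * y₇ + 2 * x₇ * y₄ + 4 * x₇ * y₅ + 4 * x₇ * y₆ + 8 * x₇ * y₇ = 1 ∧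
      x₀ * y₁ + x₁ * y₀ + x₂ * y₂ + 2 * x₂ * y₃ + 2 * x₃ * y₂ + 2 * x₃ * y₃ + 2 * x₄ * y₅ + x₄ * y₆ + 2 * x₄ * y₇ + 2 * x₅ * y₄ + 2 * x₅ * y₆ + 2 * x₅ * y₇ + x₆ * y₄ + 2 * x₆ * y₅ + 2 * x₆ * y₆ + 4 * x₆ * y₇ + 2 * x₇ * y₄ + 2 * x₇ * y₅ + 4 * x₇ * y₆ + 4 * x₇ * y₇ = 0 ∧
      x₀ * y₂ + 2 * x₁ * y₃ + x₂ * y₀ + 2 * x₃ * y₁ + x₄ * y₄ + 2 * x₄ * y₆ + 2 * x₅ * y₅ + 4 * x₅ * y₇ + 2 * x₆ * y₄ + 2 * x₆ * y₆ + 2 * x₆ * y₇ + 4 * x₇ * y₅ + 2 * x₇ * y₆ + 4 * x₇ * y₇ = 0 ∧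
      x₀ * y₃ + x₁ * y₂ + x₂ * y₁ + x₃ * y₀ + x₄ * y₅ + 2 * x₄ * y₇ + x₅ * y₄ + 2 * x₅ * y₆ + 2 * x₆ * y₅ + x₆ * y₆ + 2 * x₆ * y₇ + 2 * x₇ * y₄ + 2 * x₇ * y₆ + 2 * x₇ * y₇ = 0 ∧
      x₀ * y₄ + 2 * x₁ * y₅ + 2 * x₂ * y₆ + 2 * x₂ * y₇ + 2 * x₃ * y₆ + 4 * x₃ * y₇ + x₄ * y₀ + 2 * x₅ * y₁ + 2 * x₆ * y₂ + 2 * x₆ * y₃ + 2 * x₇ * y₂ + 4 * x₇ * y₃ = 0 ∧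
      x₀ * y₅ + x₁ * y₄ + x₂ * y₆ + 2 * x₂ * y₇ + 2 * x₃ * y₆ + 2 * x₃ * y₇ + x₄ * y₁ + x₅ * y₀ + x₆ * y₂ + 2 * x₆ * y₃ + 2 * x₇ * y₂ + 2 * x₇ * y₃ = 0 ∧
      x₀ * y₆ + 2 * x₁ * y₇ + x₂ * y₄ + 2 * x₃ * y₅ + x₄ * y₂ + 2 * x₅ * y₃ + x₆ * y₀ + 2 * x₇ * y₁ = 0 ∧
      x₀ * y₇ + x₁ * y₆ + x₂ * y₅ + x₃ * y₄ + x₄ * y₃ + x₅ * y₂ + x₆ * y₁ + x₇ * y₀ = 0) :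
    (f x₀ + f x₁ * S₁ + (f x₂ + f x₃ * S₁) * S₂ + (f x₄ + f x₅ * S₁ + (f x₆ + f x₇ * S₁) * S₂) * S₃) * (f y₀ + f y₁ * S₁ + (f y₂ + f y₃ * S₁) * S₂ + (f y₄ + f y₅ * S₁ + (f y₆ + f y₇ * S₁) * S₂) * S₃) = 1 := by
  obtain ⟨h0, h1, h2, h3, h4, h5, h6, h7⟩ := h
  rw [tower3_coordMul f hS₁ hS₂ hS₃, h0, h1, h2, h3, h4, h5, h6, h7, map_one, map_zero]; ring

/-- **`b·v = α·w + β·b²`** from the coordinate identities `q₀ v_k = P_k(α, A) + β_k q₀²`. [folklore] -/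
private theorem tower3_witness_bv (hS₁ : S₁ ^ 2 = 2) (hS₂ : S₂ ^ 2 = 2 + S₁) (hS₃ : S₃ ^ 2 = 2 + S₂)
    {q₀ v₀ v₁ v₂ v₃ v₄ v₅ v₆ v₇ α₀ α₁ α₂ α₃ α₄ α₅ α₆ α₇ β₀ β₁ β₂ β₃ β₄ β₅ β₆ β₇ A₀ A₁ A₂ A₃ A₄ A₅ A₆ A₇ : O}
    (hM2 : q₀ * v₀ = (α₀ * A₀ + 2 * α₁ * A₁ + 2 * α₂ * A₂ + 2 * α₂ * A₃ + 2 * α₃ * A₂ + 4 * α₃ * A₃ + 2 * α₄ * A₄ + 2 * α₄ * A₆ + 2 * α₄ * A₇ + 4 * α₅ * A₅ + 2 * α₅ * A₆ + 4 * α₅ * A₇ + 2 * α₆ * A₄ + 2 * α₆ * A₅ + 4 * α₆ * A₆ + 4 * α₆ * A₇ + 2 * α₇ * A₄ + 4 * α₇ * A₅ + 4 * α₇ * A₆ + 8 * α₇ * A₇) + β₀ * q₀ ^ 2 ∧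
      q₀ * v₁ = (α₀ * A₁ + α₁ * A₀ + α₂ * A₂ + 2 * α₂ * A₃ + 2 * α₃ * A₂ + 2 * α₃ * A₃ + 2 * α₄ * A₅ + α₄ * A₆ + 2 * α₄ * A₇ + 2 * α₅ * A₄ + 2 * α₅ * A₆ + 2 * α₅ * A₇ + α₆ * A₄ + 2 * α₆ * A₅ + 2 * α₆ * A₆ + 4 * α₆ * A₇ + 2 * α₇ * A₄ + 2 * α₇ * A₅ + 4 * α₇ * A₆ + 4 * α₇ * A₇) + β₁ * q₀ ^ 2 ∧
      q₀ * v₂ = (α₀ * A₂ + 2 * α₁ * A₃ + α₂ * A₀ + 2 * α₃ * A₁ + α₄ * A₄ + 2 * α₄ * A₆ + 2 * α₅ * A₅ + 4 * α₅ * A₇ + 2 * α₆ * A₄ + 2 * α₆ * A₆ + 2 * α₆ * A₇ + 4 * α₇ * A₅ + 2 * α₇ * A₆ + 4 * α₇ * A₇) + β₂ * q₀ ^ 2 ∧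
      q₀ * v₃ = (α₀ * A₃ + α₁ * A₂ + α₂ * A₁ + α₃ * A₀ + α₄ * A₅ + 2 * α₄ * A₇ + α₅ * A₄ + 2 * α₅ * A₆ + 2 * α₆ * A₅ + α₆ * A₆ + 2 * α₆ * A₇ + 2 * α₇ * A₄ + 2 * α₇ * A₆ + 2 * α₇ * A₇) + β₃ * q₀ ^ 2 ∧
      q₀ * v₄ = (α₀ * A₄ + 2 * α₁ * A₅ + 2 * α₂ * A₆ + 2 * α₂ * A₇ + 2 * α₃ * A₆ + 4 * α₃ * A₇ + α₄ * A₀ + 2 * α₅ * A₁ + 2 * α₆ * A₂ + 2 * α₆ * A₃ + 2 * α₇ * A₂ + 4 * α₇ * A₃) + β₄ * q₀ ^ 2 ∧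
      q₀ * v₅ = (α₀ * A₅ + α₁ * A₄ + α₂ * A₆ + 2 * α₂ * A₇ + 2 * α₃ * A₆ + 2 * α₃ * A₇ + α₄ * A₁ + α₅ * A₀ + α₆ * A₂ + 2 * α₆ * A₃ + 2 * α₇ * A₂ + 2 * α₇ * A₃) + β₅ * q₀ ^ 2 ∧
      q₀ * v₆ = (α₀ * A₆ + 2 * α₁ * A₇ + α₂ * A₄ + 2 * α₃ * A₅ + α₄ * A₂ + 2 * α₅ * A₃ + α₆ * A₀ + 2 * α₇ * A₁) + β₆ * q₀ ^ 2 ∧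
      q₀ * v₇ = (α₀ * A₇ + α₁ * A₆ + α₂ * A₅ + α₃ * A₄ + α₄ * A₃ + α₅ * A₂ + α₆ * A₁ + α₇ * A₀) + β₇ * q₀ ^ 2) :
    f q₀ * (f v₀ + f v₁ * S₁ + (f v₂ + f v₃ * S₁) * S₂ + (f v₄ + f v₅ * S₁ + (f v₆ + f v₇ * S₁) * S₂) * S₃) =
      (f α₀ + f α₁ * S₁ + (f α₂ + f α₃ * S₁) * S₂ + (f α₄ + f α₅ * S₁ + (f α₆ + f α₇ * S₁) * S₂) * S₃) * (f A₀ + f A₁ * S₁ + (f A₂ + f A₃ * S₁) * S₂ + (f A₄ + f A₅ * S₁ + (f A₆ + f A₇ * S₁) * S₂) * S₃) +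
      (f β₀ + f β₁ * S₁ + (f β₂ + f β₃ * S₁) * S₂ + (f β₄ + f β₅ * S₁ + (f β₆ + f β₇ * S₁) * S₂) * S₃) * (f q₀) ^ 2 := by
  obtain ⟨h0, h1, h2, h3, h4, h5, h6, h7⟩ := hM2
  have e0 := congrArg f h0
  have e1 := congrArg f h1
  have e2 := congrArg f h2
  have e3 := congrArg f h3
  have e4 := congrArg f h4
  have e5 := congrArg f h5
  have e6 := congrArg f h6
  have e7 := congrArg f h7
  simp only [map_add, map_mul, map_pow, map_ofNat] at e0 e1 e2 e3 e4 e5 e6 e7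
  rw [tower3_coordMul f hS₁ hS₂ hS₃]
  simp only [map_add, map_mul, map_ofNat]
  linear_combination e0 + S₁ * e1 + S₂ * e2 + S₁ * S₂ * e3 + S₃ * e4 + S₁ * S₃ * e5 + S₂ * S₃ * e6 + S₁ * S₂ * S₃ * e7

/-- **`v² = γ·w + δ·b²`** from `V = v ⋆ v` and `V_k = P_k(γ, A) + δ_k q₀²`. [folklore] -/
private theorem tower3_witness_vv (hS₁ : S₁ ^ 2 = 2) (hS₂ : S₂ ^ 2 = 2 + S₁) (hS₃ : S₃ ^ 2 = 2 + S₂)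
    {q₀ v₀ v₁ v₂ v₃ v₄ v₅ v₆ v₇ V₀ V₁ V₂ V₃ V₄ V₅ V₆ V₇ γ₀ γ₁ γ₂ γ₃ γ₄ γ₅ γ₆ γ₇ δ₀ δ₁ δ₂ δ₃ δ₄ δ₅ δ₆ δ₇ A₀ A₁ A₂ A₃ A₄ A₅ A₆ A₇ : O}
    (hV : v₀ * v₀ + 2 * v₁ * v₁ + 2 * v₂ * v₂ + 2 * v₂ * v₃ + 2 * v₃ * v₂ + 4 * v₃ * v₃ + 2 * v₄ * v₄ + 2 * v₄ * v₆ + 2 * v₄ * v₇ + 4 * v₅ * v₅ + 2 * v₅ * v₆ + 4 * v₅ * v₇ + 2 * v₆ * v₄ + 2 * v₆ * v₅ + 4 * v₆ * v₆ + 4 * v₆ * v₇ + 2 * v₇ * v₄ + 4 * v₇ * v₅ + 4 * v₇ * v₆ + 8 * v₇ * v₇ = V₀ ∧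
      v₀ * v₁ + v₁ * v₀ + v₂ * v₂ + 2 * v₂ * v₃ + 2 * v₃ * v₂ + 2 * v₃ * v₃ + 2 * v₄ * v₅ + v₄ * v₆ + 2 * v₄ * v₇ + 2 * v₅ * v₄ + 2 * v₅ * v₆ + 2 * v₅ * v₇ + v₆ * v₄ + 2 * v₆ * v₅ + 2 * v₆ * v₆ + 4 * v₆ * v₇ + 2 * v₇ * v₄ + 2 * v₇ * v₅ + 4 * v₇ * v₆ + 4 * v₇ * v₇ = V₁ ∧
      v₀ * v₂ + 2 * v₁ * v₃ + v₂ * v₀ + 2 * v₃ * v₁ + v₄ * v₄ + 2 * v₄ * v₆ + 2 * v₅ * v₅ + 4 * v₅ * v₇ + 2 * v₆ * v₄ + 2 * v₆ * v₆ + 2 * v₆ * v₇ + 4 * v₇ * v₅ + 2 * v₇ * v₆ + 4 * v₇ * v₇ = V₂ ∧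
      v₀ * v₃ + v₁ * v₂ + v₂ * v₁ + v₃ * v₀ + v₄ * v₅ + 2 * v₄ * v₇ + v₅ * v₄ + 2 * v₅ * v₆ + 2 * v₆ * v₅ + v₆ * v₆ + 2 * v₆ * v₇ + 2 * v₇ * v₄ + 2 * v₇ * v₆ + 2 * v₇ * v₇ = V₃ ∧
      v₀ * v₄ + 2 * v₁ * v₅ + 2 * v₂ * v₆ + 2 * v₂ * v₇ + 2 * v₃ * v₆ + 4 * v₃ * v₇ + v₄ * v₀ + 2 * v₅ * v₁ + 2 * v₆ * v₂ + 2 * v₆ * v₃ + 2 * v₇ * v₂ + 4 * v₇ * v₃ = V₄ ∧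
      v₀ * v₅ + v₁ * v₄ + v₂ * v₆ + 2 * v₂ * v₇ + 2 * v₃ * v₆ + 2 * v₃ * v₇ + v₄ * v₁ + v₅ * v₀ + v₆ * v₂ + 2 * v₆ * v₃ + 2 * v₇ * v₂ + 2 * v₇ * v₃ = V₅ ∧
      v₀ * v₆ + 2 * v₁ * v₇ + v₂ * v₄ + 2 * v₃ * v₅ + v₄ * v₂ + 2 * v₅ * v₃ + v₆ * v₀ + 2 * v₇ * v₁ = V₆ ∧
      v₀ * v₇ + v₁ * v₆ + v₂ * v₅ + v₃ * v₄ + v₄ * v₃ + v₅ * v₂ + v₆ * v₁ + v₇ * v₀ = V₇)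
    (hM3 : V₀ = (γ₀ * A₀ + 2 * γ₁ * A₁ + 2 * γ₂ * A₂ + 2 * γ₂ * A₃ + 2 * γ₃ * A₂ + 4 * γ₃ * A₃ + 2 * γ₄ * A₄ + 2 * γ₄ * A₆ + 2 * γ₄ * A₇ + 4 * γ₅ * A₅ + 2 * γ₅ * A₆ + 4 * γ₅ * A₇ + 2 * γ₆ * A₄ + 2 * γ₆ * A₅ + 4 * γ₆ * A₆ + 4 * γ₆ * A₇ + 2 * γ₇ * A₄ + 4 * γ₇ * A₅ + 4 * γ₇ * A₆ + 8 * γ₇ * A₇) + δ₀ * q₀ ^ 2 ∧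
      V₁ = (γ₀ * A₁ + γ₁ * A₀ + γ₂ * A₂ + 2 * γ₂ * A₃ + 2 * γ₃ * A₂ + 2 * γ₃ * A₃ + 2 * γ₄ * A₅ + γ₄ * A₆ + 2 * γ₄ * A₇ + 2 * γ₅ * A₄ + 2 * γ₅ * A₆ + 2 * γ₅ * A₇ + γ₆ * A₄ + 2 * γ₆ * A₅ + 2 * γ₆ * A₆ + 4 * γ₆ * A₇ + 2 * γ₇ * A₄ + 2 * γ₇ * A₅ + 4 * γ₇ * A₆ + 4 * γ₇ * A₇) + δ₁ * q₀ ^ 2 ∧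
      V₂ = (γ₀ * A₂ + 2 * γ₁ * A₃ + γ₂ * A₀ + 2 * γ₃ * A₁ + γ₄ * A₄ + 2 * γ₄ * A₆ + 2 * γ₅ * A₅ + 4 * γ₅ * A₇ + 2 * γ₆ * A₄ + 2 * γ₆ * A₆ + 2 * γ₆ * A₇ + 4 * γ₇ * A₅ + 2 * γ₇ * A₆ + 4 * γ₇ * A₇) + δ₂ * q₀ ^ 2 ∧
      V₃ = (γ₀ * A₃ + γ₁ * A₂ + γ₂ * A₁ + γ₃ * A₀ + γ₄ * A₅ + 2 * γ₄ * A₇ + γ₅ * A₄ + 2 * γ₅ * A₆ + 2 * γ₆ * A₅ + γ₆ * A₆ + 2 * γ₆ * A₇ + 2 * γ₇ * A₄ + 2 * γ₇ * A₆ + 2 * γ₇ * A₇) + δ₃ * q₀ ^ 2 ∧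
      V₄ = (γ₀ * A₄ + 2 * γ₁ * A₅ + 2 * γ₂ * A₆ + 2 * γ₂ * A₇ + 2 * γ₃ * A₆ + 4 * γ₃ * A₇ + γ₄ * A₀ + 2 * γ₅ * A₁ + 2 * γ₆ * A₂ + 2 * γ₆ * A₃ + 2 * γ₇ * A₂ + 4 * γ₇ * A₃) + δ₄ * q₀ ^ 2 ∧
      V₅ = (γ₀ * A₅ + γ₁ * A₄ + γ₂ * A₆ + 2 * γ₂ * A₇ + 2 * γ₃ * A₆ + 2 * γ₃ * A₇ + γ₄ * A₁ + γ₅ * A₀ + γ₆ * A₂ + 2 * γ₆ * A₃ + 2 * γ₇ * A₂ + 2 * γ₇ * A₃) + δ₅ * q₀ ^ 2 ∧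
      V₆ = (γ₀ * A₆ + 2 * γ₁ * A₇ + γ₂ * A₄ + 2 * γ₃ * A₅ + γ₄ * A₂ + 2 * γ₅ * A₃ + γ₆ * A₀ + 2 * γ₇ * A₁) + δ₆ * q₀ ^ 2 ∧
      V₇ = (γ₀ * A₇ + γ₁ * A₆ + γ₂ * A₅ + γ₃ * A₄ + γ₄ * A₃ + γ₅ * A₂ + γ₆ * A₁ + γ₇ * A₀) + δ₇ * q₀ ^ 2) :
    (f v₀ + f v₁ * S₁ + (f v₂ + f v₃ * S₁) * S₂ + (f v₄ + f v₅ * S₁ + (f v₆ + f v₇ * S₁) * S₂) * S₃) ^ 2 =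
      (f γ₀ + f γ₁ * S₁ + (f γ₂ + f γ₃ * S₁) * S₂ + (f γ₄ + f γ₅ * S₁ + (f γ₆ + f γ₇ * S₁) * S₂) * S₃) * (f A₀ + f A₁ * S₁ + (f A₂ + f A₃ * S₁) * S₂ + (f A₄ + f A₅ * S₁ + (f A₆ + f A₇ * S₁) * S₂) * S₃) +
      (f δ₀ + f δ₁ * S₁ + (f δ₂ + f δ₃ * S₁) * S₂ + (f δ₄ + f δ₅ * S₁ + (f δ₆ + f δ₇ * S₁) * S₂) * S₃) * (f q₀) ^ 2 := by
  have hvv : (f v₀ + f v₁ * S₁ + (f v₂ + f v₃ * S₁) * S₂ + (f v₄ + f v₅ * S₁ + (f v₆ + f v₇ * S₁) * S₂) * S₃) ^ 2 = f V₀ + f V₁ * S₁ + (f V₂ + f V₃ * S₁) * S₂ + (f V₄ + f V₅ * S₁ + (f V₆ + f V₇ * S₁) * S₂) * S₃ := by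
    obtain ⟨h0, h1, h2, h3, h4, h5, h6, h7⟩ := hV
    rw [sq, tower3_coordMul f hS₁ hS₂ hS₃, h0, h1, h2, h3, h4, h5, h6, h7]
  obtain ⟨h0, h1, h2, h3, h4, h5, h6, h7⟩ := hM3
  have e0 := congrArg f h0
  have e1 := congrArg f h1
  have e2 := congrArg f h2
  have e3 := congrArg f h3
  have e4 := congrArg f h4
  have e5 := congrArg f h5
  have e6 := congrArg f h6
  have e7 := congrArg f h7
  simp only [map_add, map_mul, map_pow, map_ofNat] at e0 e1 e2 e3 e4 e5 e6 e7
  rw [hvv, tower3_coordMul f hS₁ hS₂ hS₃]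
  simp only [map_add, map_mul, map_ofNat]
  linear_combination e0 + S₁ * e1 + S₂ * e2 + S₁ * S₂ * e3 + S₃ * e4 + S₁ * S₃ * e5 + S₂ * S₃ * e6 + S₁ * S₂ * S₃ * e7

/-- **`w = m·b² + n·(b v) + l·v²`** from `V = v ⋆ v` and `A_k = m_k q₀² + P_k(n, q₀v) + P_k(l, V)`. [folklore] -/
private theorem tower3_witness_w (hS₁ : S₁ ^ 2 = 2) (hS₂ : S₂ ^ 2 = 2 + S₁) (hS₃ : S₃ ^ 2 = 2 + S₂)
    {q₀ v₀ v₁ v₂ v₃ v₄ v₅ v₆ v₇ V₀ V₁ V₂ V₃ V₄ V₅ V₆ V₇ m₀ m₁ m₂ m₃ m₄ m₅ m₆ m₇ n₀ n₁ n₂ n₃ n₄ n₅ n₆ n₇ l₀ l₁ l₂ l₃ l₄ l₅ l₆ l₇ A₀ A₁ A₂ A₃ A₄ A₅ A₆ A₇ : O}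
    (hV : v₀ * v₀ + 2 * v₁ * v₁ + 2 * v₂ * v₂ + 2 * v₂ * v₃ + 2 * v₃ * v₂ + 4 * v₃ * v₃ + 2 * v₄ * v₄ + 2 * v₄ * v₆ + 2 * v₄ * v₇ + 4 * v₅ * v₅ + 2 * v₅ * v₆ + 4 * v₅ * v₇ + 2 * v₆ * v₄ + 2 * v₆ * v₅ + 4 * v₆ * v₆ + 4 * v₆ * v₇ + 2 * v₇ * v₄ + 4 * v₇ * v₅ + 4 * v₇ * v₆ + 8 * v₇ * v₇ = V₀ ∧
      v₀ * v₁ + v₁ * v₀ + v₂ * v₂ + 2 * v₂ * v₃ + 2 * v₃ * v₂ + 2 * v₃ * v₃ + 2 * v₄ * v₅ + v₄ * v₆ + 2 * v₄ * v₇ + 2 * v₅ * v₄ + 2 * v₅ * v₆ + 2 * v₅ * v₇ + v₆ * v₄ + 2 * v₆ * v₅ + 2 * v₆ * v₆ + 4 * v₆ * v₇ + 2 * v₇ * v₄ + 2 * v₇ * v₅ + 4 * v₇ * v₆ + 4 * v₇ * v₇ = V₁ ∧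
      v₀ * v₂ + 2 * v₁ * v₃ + v₂ * v₀ + 2 * v₃ * v₁ + v₄ * v₄ + 2 * v₄ * v₆ + 2 * v₅ * v₅ + 4 * v₅ * v₇ + 2 * v₆ * v₄ + 2 * v₆ * v₆ + 2 * v₆ * v₇ + 4 * v₇ * v₅ + 2 * v₇ * v₆ + 4 * v₇ * v₇ = V₂ ∧
      v₀ * v₃ + v₁ * v₂ + v₂ * v₁ + v₃ * v₀ + v₄ * v₅ + 2 * v₄ * v₇ + v₅ * v₄ + 2 * v₅ * v₆ + 2 * v₆ * v₅ + v₆ * v₆ + 2 * v₆ * v₇ + 2 * v₇ * v₄ + 2 * v₇ * v₆ + 2 * v₇ * v₇ = V₃ ∧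
      v₀ * v₄ + 2 * v₁ * v₅ + 2 * v₂ * v₆ + 2 * v₂ * v₇ + 2 * v₃ * v₆ + 4 * v₃ * v₇ + v₄ * v₀ + 2 * v₅ * v₁ + 2 * v₆ * v₂ + 2 * v₆ * v₃ + 2 * v₇ * v₂ + 4 * v₇ * v₃ = V₄ ∧
      v₀ * v₅ + v₁ * v₄ + v₂ * v₆ + 2 * v₂ * v₇ + 2 * v₃ * v₆ + 2 * v₃ * v₇ + v₄ * v₁ + v₅ * v₀ + v₆ * v₂ + 2 * v₆ * v₃ + 2 * v₇ * v₂ + 2 * v₇ * v₃ = V₅ ∧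
      v₀ * v₆ + 2 * v₁ * v₇ + v₂ * v₄ + 2 * v₃ * v₅ + v₄ * v₂ + 2 * v₅ * v₃ + v₆ * v₀ + 2 * v₇ * v₁ = V₆ ∧
      v₀ * v₇ + v₁ * v₆ + v₂ * v₅ + v₃ * v₄ + v₄ * v₃ + v₅ * v₂ + v₆ * v₁ + v₇ * v₀ = V₇)
    (hM4 : A₀ = m₀ * q₀ ^ 2 + (n₀ * (q₀ * v₀) + 2 * n₁ * (q₀ * v₁) + 2 * n₂ * (q₀ * v₂) + 2 * n₂ * (q₀ * v₃) + 2 * n₃ * (q₀ * v₂) + 4 * n₃ * (q₀ * v₃) + 2 * n₄ * (q₀ * v₄) + 2 * n₄ * (q₀ * v₆) + 2 * n₄ * (q₀ * v₇) + 4 * n₅ * (q₀ * v₅) + 2 * n₅ * (q₀ * v₆) + 4 * n₅ * (q₀ * v₇) + 2 * n₆ * (q₀ * v₄) + 2 * n₆ * (q₀ * v₅) + 4 * n₆ * (q₀ * v₆) + 4 * n₆ * (q₀ * v₇) + 2 * n₇ * (q₀ * v₄) + 4 * n₇ * (q₀ * v₅) + 4 * n₇ * (q₀ * v₆) + 8 *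 n₇ * (q₀ * v₇)) + (l₀ * V₀ + 2 * l₁ * V₁ + 2 * l₂ * V₂ + 2 * l₂ * V₃ + 2 * l₃ * V₂ + 4 * l₃ * V₃ + 2 * l₄ * V₄ + 2 * l₄ * V₆ + 2 * l₄ * V₇ + 4 * l₅ * V₅ + 2 * l₅ * V₆ + 4 * l₅ * V₇ + 2 * l₆ * V₄ + 2 * l₆ * V₅ + 4 * l₆ * V₆ + 4 * l₆ * V₇ + 2 * l₇ * V₄ + 4 * l₇ * V₅ + 4 * l₇ * V₆ + 8 * l₇ * V₇) ∧
      A₁ = m₁ * q₀ ^ 2 + (n₀ * (q₀ * v₁) + n₁ * (q₀ * v₀) + n₂ * (q₀ * v₂) + 2 * n₂ * (q₀ * v₃) + 2 * n₃ * (q₀ * v₂) + 2 * n₃ * (q₀ * v₃) + 2 * n₄ * (q₀ * v₅) + n₄ * (q₀ * v₆) + 2 * n₄ * (q₀ * v₇) + 2 * n₅ * (q₀ * v₄) + 2 * n₅ * (q₀ * v₆) + 2 * n₅ * (q₀ * v₇) + n₆ * (q₀ * v₄) + 2 * n₆ * (q₀ * v₅) + 2 * n₆ * (q₀ * v₆)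 + 4 * n₆ * (q₀ * v₇) + 2 * n₇ * (q₀ * v₄) + 2 * n₇ * (q₀ * v₅) + 4 * n₇ * (q₀ * v₆) + 4 * n₇ * (q₀ * v₇)) + (l₀ * V₁ + l₁ * V₀ + l₂ * V₂ + 2 * l₂ * V₃ + 2 * l₃ * V₂ + 2 * l₃ * V₃ + 2 * l₄ * V₅ + l₄ * V₆ + 2 * l₄ * V₇ + 2 * l₅ * V₄ + 2 * l₅ * V₆ + 2 * l₅ * V₇ + l₆ * V₄ + 2 * l₆ * V₅ + 2 * l₆ * V₆ + 4 * l₆ * V₇ + 2 * l₇ * V₄ + 2 * l₇ * V₅ + 4 * l₇ * V₆ + 4 * l₇ * V₇) ∧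
      A₂ = m₂ * q₀ ^ 2 + (n₀ * (q₀ * v₂) + 2 * n₁ * (q₀ * v₃) + n₂ * (q₀ * v₀) + 2 * n₃ * (q₀ * v₁) + n₄ * (q₀ * v₄) + 2 * n₄ * (q₀ * v₆) + 2 * n₅ * (q₀ * v₅) + 4 * n₅ * (q₀ * v₇) + 2 * n₆ * (q₀ * v₄) + 2 * n₆ * (q₀ * v₆) + 2 * n₆ * (q₀ * v₇) + 4 * n₇ * (q₀ * v₅) + 2 * n₇ * (q₀ * v₆) + 4 * n₇ * (q₀ * v₇)) + (l₀ * V₂ + 2 * l₁ * V₃ + l₂ * V₀ + 2 * l₃ * V₁ + l₄ * V₄ + 2 * l₄ * V₆ + 2 * l₅ * V₅ + 4 * l₅ * V₇ + 2 * l₆ * V₄ + 2 * l₆ * V₆ + 2 * l₆ * V₇ + 4 * l₇ * V₅ + 2 * l₇ * V₆ + 4 * l₇ * V₇) ∧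
      A₃ = m₃ * q₀ ^ 2 + (n₀ * (q₀ * v₃) + n₁ * (q₀ * v₂) + n₂ * (q₀ * v₁) + n₃ * (q₀ * v₀) + n₄ * (q₀ * v₅) + 2 * n₄ * (q₀ * v₇) + n₅ * (q₀ * v₄) + 2 * n₅ * (q₀ * v₆) + 2 * n₆ * (q₀ * v₅) + n₆ * (q₀ * v₆) + 2 * n₆ * (q₀ * v₇) + 2 * n₇ * (q₀ * v₄) + 2 * n₇ * (q₀ * v₆) + 2 * n₇ * (q₀ * v₇)) + (l₀ * V₃ + l₁ * V₂ + l₂ * V₁ + l₃ * V₀ + l₄ * V₅ + 2 * l₄ * V₇ + l₅ * V₄ + 2 * l₅ * V₆ + 2 * l₆ * V₅ + l₆ * V₆ + 2 * l₆ * V₇ + 2 * l₇ * V₄ + 2 * l₇ * V₆ + 2 * l₇ * V₇) ∧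
      A₄ = m₄ * q₀ ^ 2 + (n₀ * (q₀ * v₄) + 2 * n₁ * (q₀ * v₅) + 2 * n₂ * (q₀ * v₆) + 2 * n₂ * (q₀ * v₇) + 2 * n₃ * (q₀ * v₆) + 4 * n₃ * (q₀ * v₇) + n₄ * (q₀ * v₀) + 2 * n₅ * (q₀ * v₁) + 2 * n₆ * (q₀ * v₂) + 2 * n₆ * (q₀ * v₃) + 2 * n₇ * (q₀ * v₂) + 4 * n₇ * (q₀ * v₃)) + (l₀ * V₄ + 2 * l₁ * V₅ + 2 * l₂ * V₆ + 2 * l₂ * V₇ + 2 * l₃ * V₆ + 4 * l₃ * V₇ + l₄ * V₀ + 2 * l₅ * V₁ + 2 * l₆ * V₂ + 2 * l₆ * V₃ + 2 * l₇ * V₂ + 4 * l₇ * V₃) ∧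
      A₅ = m₅ * q₀ ^ 2 + (n₀ * (q₀ * v₅) + n₁ * (q₀ * v₄) + n₂ * (q₀ * v₆) + 2 * n₂ * (q₀ * v₇) + 2 * n₃ * (q₀ * v₆) + 2 * n₃ * (q₀ * v₇) + n₄ * (q₀ * v₁) + n₅ * (q₀ * v₀) + n₆ * (q₀ * v₂) + 2 * n₆ * (q₀ * v₃) + 2 * n₇ * (q₀ * v₂) + 2 * n₇ * (q₀ * v₃)) + (l₀ * V₅ + l₁ * V₄ + l₂ * V₆ + 2 * l₂ * V₇ + 2 * l₃ * V₆ + 2 * l₃ * V₇ + l₄ * V₁ + l₅ * V₀ + l₆ * V₂ + 2 * l₆ * V₃ + 2 * l₇ * V₂ + 2 * l₇ * V₃) ∧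
      A₆ = m₆ * q₀ ^ 2 + (n₀ * (q₀ * v₆) + 2 * n₁ * (q₀ * v₇) + n₂ * (q₀ * v₄) + 2 * n₃ * (q₀ * v₅) + n₄ * (q₀ * v₂) + 2 * n₅ * (q₀ * v₃) + n₆ * (q₀ * v₀) + 2 * n₇ * (q₀ * v₁)) + (l₀ * V₆ + 2 * l₁ * V₇ + l₂ * V₄ + 2 * l₃ * V₅ + l₄ * V₂ + 2 * l₅ * V₃ + l₆ * V₀ + 2 * l₇ * V₁) ∧
      A₇ = m₇ * q₀ ^ 2 + (n₀ * (q₀ * v₇) + n₁ * (q₀ * v₆) + n₂ * (q₀ * v₅) + n₃ * (q₀ * v₄) + n₄ * (q₀ * v₃) + n₅ * (q₀ * v₂) + n₆ * (q₀ * v₁) + n₇ * (q₀ * v₀)) + (l₀ * V₇ + l₁ * V₆ + l₂ * V₅ + l₃ * V₄ + l₄ * V₃ + l₅ * V₂ + l₆ * V₁ + l₇ * V₀)) :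
    (f A₀ + f A₁ * S₁ + (f A₂ + f A₃ * S₁) * S₂ + (f A₄ + f A₅ * S₁ + (f A₆ + f A₇ * S₁) * S₂) * S₃) =
      (f m₀ + f m₁ * S₁ + (f m₂ + f m₃ * S₁) * S₂ + (f m₄ + f m₅ * S₁ + (f m₆ + f m₇ * S₁) * S₂) * S₃) * (f q₀) ^ 2 +
      (f n₀ + f n₁ * S₁ + (f n₂ + f n₃ * S₁) * S₂ + (f n₄ + f n₅ * S₁ + (f n₆ + f n₇ * S₁) * S₂) * S₃) * (f q₀ * (f v₀ + f v₁ * S₁ + (f v₂ + f v₃ * S₁) * S₂ + (f v₄ + f v₅ * S₁ + (f v₆ + f v₇ * S₁) * S₂) * S₃)) +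
      (f l₀ + f l₁ * S₁ + (f l₂ + f l₃ * S₁) * S₂ + (f l₄ + f l₅ * S₁ + (f l₆ + f l₇ * S₁) * S₂) * S₃) * (f v₀ + f v₁ * S₁ + (f v₂ + f v₃ * S₁) * S₂ + (f v₄ + f v₅ * S₁ + (f v₆ + f v₇ * S₁) * S₂) * S₃) ^ 2 := by
  have hvv : (f v₀ + f v₁ * S₁ + (f v₂ + f v₃ * S₁) * S₂ + (f v₄ + f v₅ * S₁ + (f v₆ + f v₇ * S₁) * S₂) * S₃) ^ 2 = f V₀ + f V₁ * S₁ + (f V₂ + f V₃ * S₁) * S₂ + (f V₄ + f V₅ * S₁ + (f V₆ + f V₇ * S₁) * S₂) * S₃ := by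
    obtain ⟨h0, h1, h2, h3, h4, h5, h6, h7⟩ := hV
    rw [sq, tower3_coordMul f hS₁ hS₂ hS₃, h0, h1, h2, h3, h4, h5, h6, h7]
  have hbv : f q₀ * (f v₀ + f v₁ * S₁ + (f v₂ + f v₃ * S₁) * S₂ + (f v₄ + f v₅ * S₁ + (f v₆ + f v₇ * S₁) * S₂) * S₃) = f (q₀ * v₀) + f (q₀ * v₁) * S₁ + (f (q₀ * v₂) + f (q₀ * v₃) * S₁) * S₂ + (f (q₀ * v₄) + f (q₀ * v₅) * S₁ + (f (q₀ * v₆) + f (q₀ * v₇) * S₁) * S₂) * S₃ := by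
    simp only [map_mul]; ring
  obtain ⟨h0, h1, h2, h3, h4, h5, h6, h7⟩ := hM4
  have e0 := congrArg f h0
  have e1 := congrArg f h1
  have e2 := congrArg f h2
  have e3 := congrArg f h3
  have e4 := congrArg f h4
  have e5 := congrArg f h5
  have e6 := congrArg f h6
  have e7 := congrArg f h7
  simp only [map_add, map_mul, map_pow, map_ofNat] at e0 e1 e2 e3 e4 e5 e6 e7
  rw [hvv, hbv, tower3_coordMul f hS₁ hS₂ hS₃, tower3_coordMul f hS₁ hS₂ hS₃]
  simp only [map_add, map_mul, map_ofNat]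
  linear_combination e0 + S₁ * e1 + S₂ * e2 + S₁ * S₂ * e3 + S₃ * e4 + S₁ * S₃ * e5 + S₂ * S₃ * e6 + S₁ * S₂ * S₃ * e7

/-- **`b⁴ = w·w*`** from `q₀⁴ = P₀(A, W)`, `0 = P_k(A, W)` (`k ≥ 1`). [folklore] -/
private theorem tower3_witness_b4 (hS₁ : S₁ ^ 2 = 2) (hS₂ : S₂ ^ 2 = 2 + S₁) (hS₃ : S₃ ^ 2 = 2 + S₂)
    {q₀ A₀ A₁ A₂ A₃ A₄ A₅ A₆ A₇ W₀ W₁ W₂ W₃ W₄ W₅ W₆ W₇ : O}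
    (hws : q₀ ^ 4 = A₀ * W₀ + 2 * A₁ * W₁ + 2 * A₂ * W₂ + 2 * A₂ * W₃ + 2 * A₃ * W₂ + 4 * A₃ * W₃ + 2 * A₄ * W₄ + 2 * A₄ * W₆ + 2 * A₄ * W₇ + 4 * A₅ * W₅ + 2 * A₅ * W₆ + 4 * A₅ * W₇ + 2 * A₆ * W₄ + 2 * A₆ * W₅ + 4 * A₆ * W₆ + 4 * A₆ * W₇ + 2 * A₇ * W₄ + 4 * A₇ * W₅ + 4 * A₇ * W₆ + 8 * A₇ * W₇ ∧
      (0 : O) = A₀ * W₁ + A₁ * W₀ + A₂ * W₂ + 2 * A₂ * W₃ + 2 * A₃ * W₂ + 2 * A₃ * W₃ + 2 * A₄ * W₅ + A₄ * W₆ + 2 * A₄ * W₇ + 2 * A₅ * W₄ + 2 * A₅ * W₆ + 2 * A₅ * W₇ + A₆ * W₄ + 2 * A₆ * W₅ + 2 * A₆ * W₆ + 4 * A₆ * W₇ + 2 * A₇ * W₄ + 2 * A₇ * W₅ + 4 * A₇ * W₆ + 4 * A₇ * W₇ ∧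
      (0 : O) = A₀ * W₂ + 2 * A₁ * W₃ + A₂ * W₀ + 2 * A₃ * W₁ + A₄ * W₄ + 2 * A₄ * W₆ + 2 * A₅ * W₅ + 4 * A₅ * W₇ + 2 * A₆ * W₄ + 2 * A₆ * W₆ + 2 * A₆ * W₇ + 4 * A₇ * W₅ + 2 * A₇ * W₆ + 4 * A₇ * W₇ ∧
      (0 : O) = A₀ * W₃ + A₁ * W₂ + A₂ * W₁ + A₃ * W₀ + A₄ * W₅ + 2 * A₄ * W₇ + A₅ * W₄ + 2 * A₅ * W₆ + 2 * A₆ * W₅ + A₆ * W₆ + 2 * A₆ * W₇ + 2 * A₇ * W₄ + 2 * A₇ * W₆ + 2 * A₇ * W₇ ∧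
      (0 : O) = A₀ * W₄ + 2 * A₁ * W₅ + 2 * A₂ * W₆ + 2 * A₂ * W₇ + 2 * A₃ * W₆ + 4 * A₃ * W₇ + A₄ * W₀ + 2 * A₅ * W₁ + 2 * A₆ * W₂ + 2 * A₆ * W₃ + 2 * A₇ * W₂ + 4 * A₇ * W₃ ∧
      (0 : O) = A₀ * W₅ + A₁ * W₄ + A₂ * W₆ + 2 * A₂ * W₇ + 2 * A₃ * W₆ + 2 * A₃ * W₇ + A₄ * W₁ + A₅ * W₀ + A₆ * W₂ + 2 * A₆ * W₃ + 2 * A₇ * W₂ + 2 * A₇ * W₃ ∧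
      (0 : O) = A₀ * W₆ + 2 * A₁ * W₇ + A₂ * W₄ + 2 * A₃ * W₅ + A₄ * W₂ + 2 * A₅ * W₃ + A₆ * W₀ + 2 * A₇ * W₁ ∧
      (0 : O) = A₀ * W₇ + A₁ * W₆ + A₂ * W₅ + A₃ * W₄ + A₄ * W₃ + A₅ * W₂ + A₆ * W₁ + A₇ * W₀) :
    (f q₀) ^ 4 = (f A₀ + f A₁ * S₁ + (f A₂ + f A₃ * S₁) * S₂ + (f A₄ + f A₅ * S₁ + (f A₆ + f A₇ * S₁) * S₂) * S₃) * (f W₀ + f W₁ * S₁ + (f W₂ + f W₃ * S₁) * S₂ + (f W₄ + f W₅ * S₁ + (f W₆ + f W₇ * S₁) * S₂) * S₃) := by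
  obtain ⟨h0, h1, h2, h3, h4, h5, h6, h7⟩ := hws
  have e0 := congrArg f h0
  have e1 := congrArg f h1
  have e2 := congrArg f h2
  have e3 := congrArg f h3
  have e4 := congrArg f h4
  have e5 := congrArg f h5
  have e6 := congrArg f h6
  have e7 := congrArg f h7
  simp only [map_add, map_mul, map_pow, map_ofNat, map_zero] at e0 e1 e2 e3 e4 e5 e6 e7
  rw [tower3_coordMul f hS₁ hS₂ hS₃]
  simp only [map_add, map_mul, map_ofNat]
  linear_combination e0 + S₁ * e1 + S₂ * e2 + S₁ * S₂ * e3 + S₃ * e4 + S₁ * S₃ * e5 + S₂ * S₃ * e6 + S₁ * S₂ * S₃ * e7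

/-- **Bézout `μ·w + ν·w* = 1`** from the coordinate identities. [folklore] -/
private theorem tower3_witness_bezout (hS₁ : S₁ ^ 2 = 2) (hS₂ : S₂ ^ 2 = 2 + S₁) (hS₃ : S₃ ^ 2 = 2 + S₂)
    {μ₀ μ₁ μ₂ μ₃ μ₄ μ₅ μ₆ μ₇ ν₀ ν₁ ν₂ ν₃ ν₄ ν₅ ν₆ ν₇ A₀ A₁ A₂ A₃ A₄ A₅ A₆ A₇ W₀ W₁ W₂ W₃ W₄ W₅ W₆ W₇ : O}
    (hbez : (μ₀ * A₀ + 2 * μ₁ * A₁ + 2 * μ₂ * A₂ + 2 * μ₂ * A₃ + 2 * μ₃ * A₂ + 4 * μ₃ * A₃ + 2 * μ₄ * A₄ + 2 * μ₄ * A₆ + 2 * μ₄ * A₇ + 4 * μ₅ * A₅ + 2 * μ₅ * A₆ + 4 * μ₅ * A₇ + 2 * μ₆ * A₄ + 2 * μ₆ * A₅ + 4 * μ₆ * A₆ + 4 * μ₆ * A₇ + 2 * μ₇ * A₄ + 4 * μ₇ * A₅ + 4 * μ₇ * A₆ + 8 * μ₇ * A₇) + (ν₀ * W₀ + 2 * ν₁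 * W₁ + 2 * ν₂ * W₂ + 2 * ν₂ * W₃ + 2 * ν₃ * W₂ + 4 * ν₃ * W₃ + 2 * ν₄ * W₄ + 2 * ν₄ * W₆ + 2 * ν₄ * W₇ + 4 * ν₅ * W₅ + 2 * ν₅ * W₆ + 4 * ν₅ * W₇ + 2 * ν₆ * W₄ + 2 * ν₆ * W₅ + 4 * ν₆ * W₆ + 4 * ν₆ * W₇ + 2 * ν₇ * W₄ + 4 * ν₇ * W₅ + 4 * ν₇ * W₆ + 8 * ν₇ * W₇) = 1 ∧
      (μ₀ * A₁ + μ₁ * A₀ + μ₂ * A₂ + 2 * μ₂ * A₃ + 2 * μ₃ * A₂ + 2 * μ₃ * A₃ + 2 * μ₄ * A₅ + μ₄ * A₆ + 2 * μ₄ * A₇ + 2 * μ₅ * A₄ + 2 * μ₅ * A₆ + 2 * μ₅ * A₇ + μ₆ * A₄ + 2 * μ₆ * A₅ + 2 * μ₆ * A₆ + 4 * μ₆ * A₇ + 2 * μ₇ * A₄ + 2 * μ₇ * A₅ + 4 * μ₇ * A₆ + 4 * μ₇ * A₇) + (ν₀ * W₁ + ν₁ * W₀ + ν₂ * W₂ +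 2 * ν₂ * W₃ + 2 * ν₃ * W₂ + 2 * ν₃ * W₃ + 2 * ν₄ * W₅ + ν₄ * W₆ + 2 * ν₄ * W₇ + 2 * ν₅ * W₄ + 2 * ν₅ * W₆ + 2 * ν₅ * W₇ + ν₆ * W₄ + 2 * ν₆ * W₅ + 2 * ν₆ * W₆ + 4 * ν₆ * W₇ + 2 * ν₇ * W₄ + 2 * ν₇ * W₅ + 4 * ν₇ * W₆ + 4 * ν₇ * W₇) = 0 ∧
      (μ₀ * A₂ + 2 * μ₁ * A₃ + μ₂ * A₀ + 2 * μ₃ * A₁ + μ₄ * A₄ + 2 * μ₄ * A₆ + 2 * μ₅ * A₅ + 4 * μ₅ * A₇ + 2 * μ₆ * A₄ + 2 * μ₆ * A₆ + 2 * μ₆ * A₇ + 4 * μ₇ * A₅ + 2 * μ₇ * A₆ + 4 * μ₇ * A₇) + (ν₀ * W₂ + 2 * ν₁ * W₃ + ν₂ * W₀ + 2 * ν₃ * W₁ + ν₄ * W₄ + 2 * ν₄ * W₆ + 2 * ν₅ * W₅ + 4 * ν₅ * W₇ + 2 * ν₆ * W₄ + 2 * ν₆ * W₆ + 2 * ν₆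 * W₇ + 4 * ν₇ * W₅ + 2 * ν₇ * W₆ + 4 * ν₇ * W₇) = 0 ∧
      (μ₀ * A₃ + μ₁ * A₂ + μ₂ * A₁ + μ₃ * A₀ + μ₄ * A₅ + 2 * μ₄ * A₇ + μ₅ * A₄ + 2 * μ₅ * A₆ + 2 * μ₆ * A₅ + μ₆ * A₆ + 2 * μ₆ * A₇ + 2 * μ₇ * A₄ + 2 * μ₇ * A₆ + 2 * μ₇ * A₇) + (ν₀ * W₃ + ν₁ * W₂ + ν₂ * W₁ + ν₃ * W₀ + ν₄ * W₅ + 2 * ν₄ * W₇ + ν₅ * W₄ + 2 * ν₅ * W₆ + 2 * ν₆ * W₅ + ν₆ * W₆ + 2 * ν₆ * W₇ + 2 * ν₇ * W₄ + 2 * ν₇ * W₆ + 2 * ν₇ * W₇) = 0 ∧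
      (μ₀ * A₄ + 2 * μ₁ * A₅ + 2 * μ₂ * A₆ + 2 * μ₂ * A₇ + 2 * μ₃ * A₆ + 4 * μ₃ * A₇ + μ₄ * A₀ + 2 * μ₅ * A₁ + 2 * μ₆ * A₂ + 2 * μ₆ * A₃ + 2 * μ₇ * A₂ + 4 * μ₇ * A₃) + (ν₀ * W₄ + 2 * ν₁ * W₅ + 2 * ν₂ * W₆ + 2 * ν₂ * W₇ + 2 * ν₃ * W₆ + 4 * ν₃ * W₇ + ν₄ * W₀ + 2 * ν₅ * W₁ + 2 * ν₆ * W₂ + 2 * ν₆ * W₃ + 2 * ν₇ * W₂ + 4 * ν₇ * W₃) = 0 ∧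
      (μ₀ * A₅ + μ₁ * A₄ + μ₂ * A₆ + 2 * μ₂ * A₇ + 2 * μ₃ * A₆ + 2 * μ₃ * A₇ + μ₄ * A₁ + μ₅ * A₀ + μ₆ * A₂ + 2 * μ₆ * A₃ + 2 * μ₇ * A₂ + 2 * μ₇ * A₃) + (ν₀ * W₅ + ν₁ * W₄ + ν₂ * W₆ + 2 * ν₂ * W₇ + 2 * ν₃ * W₆ + 2 * ν₃ * W₇ + ν₄ * W₁ + ν₅ * W₀ + ν₆ * W₂ + 2 * ν₆ * W₃ + 2 * ν₇ * W₂ + 2 * ν₇ * W₃) = 0 ∧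
      (μ₀ * A₆ + 2 * μ₁ * A₇ + μ₂ * A₄ + 2 * μ₃ * A₅ + μ₄ * A₂ + 2 * μ₅ * A₃ + μ₆ * A₀ + 2 * μ₇ * A₁) + (ν₀ * W₆ + 2 * ν₁ * W₇ + ν₂ * W₄ + 2 * ν₃ * W₅ + ν₄ * W₂ + 2 * ν₅ * W₃ + ν₆ * W₀ + 2 * ν₇ * W₁) = 0 ∧
      (μ₀ * A₇ + μ₁ * A₆ + μ₂ * A₅ + μ₃ * A₄ + μ₄ * A₃ + μ₅ * A₂ + μ₆ * A₁ + μ₇ * A₀) + (ν₀ * W₇ + ν₁ * W₆ + ν₂ * W₅ + ν₃ * W₄ + ν₄ * W₃ + ν₅ * W₂ + ν₆ * W₁ + ν₇ * W₀) = 0) :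
    (f μ₀ + f μ₁ * S₁ + (f μ₂ + f μ₃ * S₁) * S₂ + (f μ₄ + f μ₅ * S₁ + (f μ₆ + f μ₇ * S₁) * S₂) * S₃) * (f A₀ + f A₁ * S₁ + (f A₂ + f A₃ * S₁) * S₂ + (f A₄ + f A₅ * S₁ + (f A₆ + f A₇ * S₁) * S₂) * S₃) +
      (f ν₀ + f ν₁ * S₁ + (f ν₂ + f ν₃ * S₁) * S₂ + (f ν₄ + f ν₅ * S₁ + (f ν₆ + f ν₇ * S₁) * S₂) * S₃) * (f W₀ + f W₁ * S₁ + (f W₂ + f W₃ * S₁) * S₂ + (f W₄ + f W₅ * S₁ + (f W₆ + f W₇ * S₁) * S₂) * S₃) = 1 := by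
  obtain ⟨h0, h1, h2, h3, h4, h5, h6, h7⟩ := hbez
  have e0 := congrArg f h0
  have e1 := congrArg f h1
  have e2 := congrArg f h2
  have e3 := congrArg f h3
  have e4 := congrArg f h4
  have e5 := congrArg f h5
  have e6 := congrArg f h6
  have e7 := congrArg f h7
  simp only [map_add, map_mul, map_ofNat, map_one, map_zero] at e0 e1 e2 e3 e4 e5 e6 e7
  rw [tower3_coordMul f hS₁ hS₂ hS₃, tower3_coordMul f hS₁ hS₂ hS₃]
  simp only [map_add, map_mul, map_ofNat]
  linear_combination e0 + S₁ * e1 + S₂ * e2 + S₁ * S₂ * e3 + S₃ * e4 + S₁ * S₃ * e5 + S₂ * S₃ * e6 + S₁ * S₂ * S₃ * e7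

end Algebra

/-- `s₂ ∉ K_1` for a root `s₂ ∈ K_2` of `X⁴ − 4X² + 2` over an odd-degree `K` (its minimal polynomial has degree `4 > [K_1 : K] = 2`).
[cite: Washington1997, §13.1] -/
private theorem forall_algebraMap_ne_of_quartic_layer (hodd : Odd (Module.finrank ℚ K)) (κ : ZpExtension K 2)
    [Algebra (κ.layer 1) (κ.layer 2)] {s₂ : κ.layer 2} (hquart : s₂ ^ 4 - 4 * s₂ ^ 2 + 2 = 0) :
    ∀ x : κ.layer 1, algebraMap (κ.layer 1) (κ.layer 2) x ≠ s₂ := by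
  haveI : Fact (Nat.Prime 2) := ⟨Nat.prime_two⟩
  haveI : FiniteDimensional K (κ.layer 1) := κ.finiteDimensional_layer_holds 1
  have hdeg1 : Module.finrank K (κ.layer 1) = 2 := by rw [κ.finrank_layer_holds 1, pow_one]
  intro a ha
  have ha4 : a ^ 4 - 4 * a ^ 2 + 2 = 0 := by
    apply (algebraMap (κ.layer 1) (κ.layer 2)).injective
    rw [map_add, map_sub, map_mul, map_pow, map_pow, map_ofNat, map_ofNat, map_zero, ha, hquart]
  have h4 := finrank_adjoin_quartic_root hodd a ha4
  have htower := Module.finrank_mul_finrank K (IntermediateField.adjoin K ({a} : Set (κ.layer 1))) (κ.layer 1)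
  rw [h4, hdeg1] at htower
  omega



/-- **Generators of the three layers**: `s₁ ∈ K_1`, `s₂ ∈ K_2`, `s₃ ∈ K_3` with `s₁² = 2`, `s₂² = 2 + s₁`, `s₃² = 2 + s₂`, each outside the previous layer
(`2 ∤ [K:ℚ]`, `2 ∤ d_K`, `κ` cyclotomic; assembled from the tree's layer-one, layer-two and layer-three generator lemmas, the sign of `s₁` chosen so that
`s₂² − 2 = s₁`). [cite: Washington1997, §13.1 (`K_n = K·ℚ(ζ_{2^{n+2}})⁺`)] -/
theorem exists_generators_three_layers (hK : ¬ 2 ∣ Module.finrank ℚ K) (hd : ¬ (2 : ℤ) ∣ NumberField.discr K)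
    (κ : ZpExtension K 2) (hκ : κ.IsCyclotomic)
    [Algebra (κ.layer 1) (κ.layer 2)] [IsScalarTower K (κ.layer 1) (κ.layer 2)] [Algebra (κ.layer 2) (κ.layer 3)] [IsScalarTower K (κ.layer 2) (κ.layer 3)] :
    ∃ (s₁ : κ.layer 1) (s₂ : κ.layer 2) (s₃ : κ.layer 3), s₁ ^ 2 = 2 ∧ s₂ ^ 2 = algebraMap (κ.layer 1) (κ.layer 2) (2 + s₁) ∧
      s₃ ^ 2 = algebraMap (κ.layer 2) (κ.layer 3) (2 + s₂) ∧ (∀ x : K, algebraMap K (κ.layer 1) x ≠ s₁) ∧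
      (∀ x : κ.layer 1, algebraMap (κ.layer 1) (κ.layer 2) x ≠ s₂) ∧ (∀ x : κ.layer 2, algebraMap (κ.layer 2) (κ.layer 3) x ≠ s₃) := by
  haveI : Fact (Nat.Prime 2) := ⟨Nat.prime_two⟩
  letI : Algebra (κ.layer 1) (κ.layer (1 + 1)) := ‹Algebra (κ.layer 1) (κ.layer 2)›
  haveI : IsScalarTower K (κ.layer 1) (κ.layer (1 + 1)) := ‹IsScalarTower K (κ.layer 1) (κ.layer 2)›
  letI : Algebra (κ.layer 2) (κ.layer (2 + 1)) := ‹Algebra (κ.layer 2) (κ.layer 3)›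
  haveI : IsScalarTower K (κ.layer 2) (κ.layer (2 + 1)) := ‹IsScalarTower K (κ.layer 2) (κ.layer 3)›
  have hodd : Odd (Module.finrank ℚ K) := Nat.odd_iff.mpr (Nat.two_dvd_ne_zero.mp hK)
  obtain ⟨s, hs⟩ := exists_sq_eq_two_layer_one_of_not_dvd_finrank hK κ hκ
  obtain ⟨s₂', hq, s₃', hs₃', hs₃K''⟩ := exists_quartic_root_layer_two_sqrt_add_layer_three κ hK hκ
  set s₂ : κ.layer 2 := s₂' with hs₂def
  set s₃ : κ.layer 3 := s₃' with hs₃def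
  have hquart : s₂ ^ 4 - 4 * s₂ ^ 2 + 2 = 0 := hq
  have hs₃ : s₃ ^ 2 = algebraMap (κ.layer 2) (κ.layer 3) (2 + s₂) := hs₃'
  have hs₃K : ∀ x : κ.layer 2, algebraMap (κ.layer 2) (κ.layer 3) x ≠ s₃ := fun x hx => hs₃K'' ⟨x, hx⟩
  clear_value s₂ s₃
  clear hq hs₃' hs₃K'' hs₂def hs₃def
  have hsq2 : (s₂ ^ 2 - 2) ^ 2 = (algebraMap (κ.layer 1) (κ.layer 2) s) ^ 2 := by
    rw [← map_pow, hs, map_ofNat]; linear_combination hquart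
  obtain ⟨s₁, hs₁, hs₂⟩ : ∃ s₁ : κ.layer 1, s₁ ^ 2 = 2 ∧ s₂ ^ 2 = algebraMap (κ.layer 1) (κ.layer 2) (2 + s₁) := by
    rcases eq_or_eq_neg_of_sq_eq_sq _ _ hsq2 with h | h
    · exact ⟨s, hs, by rw [map_add, map_ofNat, ← h]; ring⟩
    · exact ⟨-s, by rw [neg_sq, hs], by rw [map_add, map_ofNat, map_neg, ← h]; ring⟩
  exact ⟨s₁, s₂, s₃, hs₁, hs₂, hs₃, forall_algebraMap_ne_of_sq_eq_two hd hs₁,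
    forall_algebraMap_ne_of_quartic_layer hodd κ hquart, hs₃K⟩

set_option maxHeartbeats 1600000 in
/-- ★★ **A class of order `4` in `Cl(K_3)` from a three-step tower order-four certificate in `𝓞_K`.**  `K` a number field with `2 ∤ [K:ℚ]`, `2 ∤ d_K`,
`8·#Pl_∞(K) ≤ n + 1` (so `rank E_{K_3} ≤ n`); `κ` a cyclotomic `ℤ₂`-extension (`s₁ ∈ K_1`, `s₂ ∈ K_2`, `s₃ ∈ K_3` with `s₁² = 2`, `s₂² = 2 + s₁`, `s₃² = 2 + s₂`).
DATA in `𝓞_K` (coordinates on `1, s₁, s₂, s₁s₂, s₃, s₁s₃, s₂s₃, s₁s₂s₃`, products by the three rules): `n` units `a_i` with inverses `c_i`; `w = A`, `w* = W` with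
`q₀⁴ = w·w*`; `μ w + ν w* = 1`; `q₀ ≠ 0`; `v`, `V = v²`, `q₀ v = α w + β q₀²`, `V = γ w + δ q₀²`, `w = m q₀² + n'(q₀ v) + l V`; and for every `(e, e', ±) ≠ (0, 0, +)`
a residue certificate `(ψ : 𝓞_K → ℤ/q, 2t = 1, r₁² = 2, r₂² = 2 + r₁, r₃² = 2 + r₂)` at which `±∏ sym(a_i)^{e_i} sym(A)^{e'}` is not a square.  THEN `Cl(K_3)` has a
class of order `4` (the class of `(q₀, v)`: `NumberFields.exists_orderOf_eq_four_of_tower3OrderFourCert`).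
[cite: NeukirchANT1999, Ch. I §7 Thm. (7.4), Ch. I §3, Ch. I §8] [cite: Washington1997, §13.1 (`K_3 = K·ℚ(ζ₃₂)⁺`)]
[cite: Cohen1993, §6.5 (verification of class group and unit computations)] -/
theorem exists_orderOf_eq_four_layer_three_of_tower3Cert (hK : ¬ 2 ∣ Module.finrank ℚ K) (hd : ¬ (2 : ℤ) ∣ NumberField.discr K)
    {n : ℕ} (hPl : 8 * Fintype.card (NumberField.InfinitePlace K) ≤ n + 1)
    (κ : ZpExtension K 2) (hκ : κ.IsCyclotomic)
    (a₀ a₁ a₂ a₃ a₄ a₅ a₆ a₇ c₀ c₁ c₂ c₃ c₄ c₅ c₆ c₇ : Fin n → 𝓞 K)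
    {A₀ A₁ A₂ A₃ A₄ A₅ A₆ A₇ W₀ W₁ W₂ W₃ W₄ W₅ W₆ W₇ μ₀ μ₁ μ₂ μ₃ μ₄ μ₅ μ₆ μ₇ ν₀ ν₁ ν₂ ν₃ ν₄ ν₅ ν₆ ν₇ q₀ v₀ v₁ v₂ v₃ v₄ v₅ v₆ v₇ α₀ α₁ α₂ α₃ α₄ α₅ α₆ α₇ β₀ β₁ β₂ β₃ β₄ β₅ β₆ β₇ γ₀ γ₁ γ₂ γ₃ γ₄ γ₅ γ₆ γ₇ δ₀ δ₁ δ₂ δ₃ δ₄ δ₅ δ₆ δ₇ m₀ m₁ m₂ m₃ m₄ m₅ m₆ m₇ n₀ n₁ n₂ n₃ n₄ n₅ n₆ n₇ l₀ l₁ l₂ l₃ l₄ l₅ l₆ l₇ V₀ V₁ V₂ V₃ V₄ V₅ V₆ V₇ : 𝓞 K}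
    (hu : ∀ i, a₀ i * c₀ i + 2 * a₁ i * c₁ i + 2 * a₂ i * c₂ i + 2 * a₂ i * c₃ i + 2 * a₃ i * c₂ i + 4 * a₃ i * c₃ i + 2 * a₄ i * c₄ i + 2 * a₄ i * c₆ i + 2 * a₄ i * c₇ i + 4 * a₅ i * c₅ i + 2 * a₅ i * c₆ i + 4 * a₅ i * c₇ i + 2 * a₆ i * c₄ i + 2 * a₆ i * c₅ i + 4 * a₆ i * c₆ i + 4 * a₆ i * c₇ i + 2 * a₇ i * c₄ i + 4 * a₇ i * c₅ i + 4 * a₇ i * c₆ i + 8 * a₇ i * c₇ i = 1 ∧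
      a₀ i * c₁ i + a₁ i * c₀ i + a₂ i * c₂ i + 2 * a₂ i * c₃ i + 2 * a₃ i * c₂ i + 2 * a₃ i * c₃ i + 2 * a₄ i * c₅ i + a₄ i * c₆ i + 2 * a₄ i * c₇ i + 2 * a₅ i * c₄ i + 2 * a₅ i * c₆ i + 2 * a₅ i * c₇ i + a₆ i * c₄ i + 2 * a₆ i * c₅ i + 2 * a₆ i * c₆ i + 4 * a₆ i * c₇ i + 2 * a₇ i * c₄ i + 2 * a₇ i * c₅ i + 4 * a₇ i * c₆ i + 4 * a₇ i * c₇ i = 0 ∧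
      a₀ i * c₂ i + 2 * a₁ i * c₃ i + a₂ i * c₀ i + 2 * a₃ i * c₁ i + a₄ i * c₄ i + 2 * a₄ i * c₆ i + 2 * a₅ i * c₅ i + 4 * a₅ i * c₇ i + 2 * a₆ i * c₄ i + 2 * a₆ i * c₆ i + 2 * a₆ i * c₇ i + 4 * a₇ i * c₅ i + 2 * a₇ i * c₆ i + 4 * a₇ i * c₇ i = 0 ∧
      a₀ i * c₃ i + a₁ i * c₂ i + a₂ i * c₁ i + a₃ i * c₀ i + a₄ i * c₅ i + 2 * a₄ i * c₇ i + a₅ i * c₄ i + 2 * a₅ i * c₆ i + 2 * a₆ i * c₅ i + a₆ i * c₆ i + 2 * a₆ i * c₇ i + 2 * a₇ i * c₄ i + 2 * a₇ i * c₆ i + 2 * a₇ i * c₇ i = 0 ∧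
      a₀ i * c₄ i + 2 * a₁ i * c₅ i + 2 * a₂ i * c₆ i + 2 * a₂ i * c₇ i + 2 * a₃ i * c₆ i + 4 * a₃ i * c₇ i + a₄ i * c₀ i + 2 * a₅ i * c₁ i + 2 * a₆ i * c₂ i + 2 * a₆ i * c₃ i + 2 * a₇ i * c₂ i + 4 * a₇ i * c₃ i = 0 ∧
      a₀ i * c₅ i + a₁ i * c₄ i + a₂ i * c₆ i + 2 * a₂ i * c₇ i + 2 * a₃ i * c₆ i + 2 * a₃ i * c₇ i + a₄ i * c₁ i + a₅ i * c₀ i + a₆ i * c₂ i + 2 * a₆ i * c₃ i + 2 * a₇ i * c₂ i + 2 * a₇ i * c₃ i = 0 ∧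
      a₀ i * c₆ i + 2 * a₁ i * c₇ i + a₂ i * c₄ i + 2 * a₃ i * c₅ i + a₄ i * c₂ i + 2 * a₅ i * c₃ i + a₆ i * c₀ i + 2 * a₇ i * c₁ i = 0 ∧
      a₀ i * c₇ i + a₁ i * c₆ i + a₂ i * c₅ i + a₃ i * c₄ i + a₄ i * c₃ i + a₅ i * c₂ i + a₆ i * c₁ i + a₇ i * c₀ i = 0)
    (hws : q₀ ^ 4 = A₀ * W₀ + 2 * A₁ * W₁ + 2 * A₂ * W₂ + 2 * A₂ * W₃ + 2 * A₃ * W₂ + 4 * A₃ * W₃ + 2 * A₄ * W₄ + 2 * A₄ * W₆ + 2 * A₄ * W₇ + 4 * A₅ * W₅ + 2 * A₅ * W₆ + 4 * A₅ * W₇ + 2 * A₆ * W₄ + 2 * A₆ * W₅ + 4 * A₆ * W₆ + 4 * A₆ * W₇ + 2 * A₇ * W₄ + 4 * A₇ * W₅ + 4 * A₇ * W₆ + 8 * A₇ * W₇ ∧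
      (0 : 𝓞 K) = A₀ * W₁ + A₁ * W₀ + A₂ * W₂ + 2 * A₂ * W₃ + 2 * A₃ * W₂ + 2 * A₃ * W₃ + 2 * A₄ * W₅ + A₄ * W₆ + 2 * A₄ * W₇ + 2 * A₅ * W₄ + 2 * A₅ * W₆ + 2 * A₅ * W₇ + A₆ * W₄ + 2 * A₆ * W₅ + 2 * A₆ * W₆ + 4 * A₆ * W₇ + 2 * A₇ * W₄ + 2 * A₇ * W₅ + 4 * A₇ * W₆ + 4 * A₇ * W₇ ∧
      (0 : 𝓞 K) = A₀ * W₂ + 2 * A₁ * W₃ + A₂ * W₀ + 2 * A₃ * W₁ + A₄ * W₄ + 2 * A₄ * W₆ + 2 * A₅ * W₅ + 4 * A₅ * W₇ + 2 * A₆ * W₄ + 2 * A₆ * W₆ + 2 * A₆ * W₇ + 4 * A₇ * W₅ + 2 * A₇ * W₆ + 4 * A₇ * W₇ ∧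
      (0 : 𝓞 K) = A₀ * W₃ + A₁ * W₂ + A₂ * W₁ + A₃ * W₀ + A₄ * W₅ + 2 * A₄ * W₇ + A₅ * W₄ + 2 * A₅ * W₆ + 2 * A₆ * W₅ + A₆ * W₆ + 2 * A₆ * W₇ + 2 * A₇ * W₄ + 2 * A₇ * W₆ + 2 * A₇ * W₇ ∧
      (0 : 𝓞 K) = A₀ * W₄ + 2 * A₁ * W₅ + 2 * A₂ * W₆ + 2 * A₂ * W₇ + 2 * A₃ * W₆ + 4 * A₃ * W₇ + A₄ * W₀ + 2 * A₅ * W₁ + 2 * A₆ * W₂ + 2 * A₆ * W₃ + 2 * A₇ * W₂ + 4 * A₇ * W₃ ∧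
      (0 : 𝓞 K) = A₀ * W₅ + A₁ * W₄ + A₂ * W₆ + 2 * A₂ * W₇ + 2 * A₃ * W₆ + 2 * A₃ * W₇ + A₄ * W₁ + A₅ * W₀ + A₆ * W₂ + 2 * A₆ * W₃ + 2 * A₇ * W₂ + 2 * A₇ * W₃ ∧
      (0 : 𝓞 K) = A₀ * W₆ + 2 * A₁ * W₇ + A₂ * W₄ + 2 * A₃ * W₅ + A₄ * W₂ + 2 * A₅ * W₃ + A₆ * W₀ + 2 * A₇ * W₁ ∧
      (0 : 𝓞 K) = A₀ * W₇ + A₁ * W₆ + A₂ * W₅ + A₃ * W₄ + A₄ * W₃ + A₅ * W₂ + A₆ * W₁ + A₇ * W₀)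
    (hbez : (μ₀ * A₀ + 2 * μ₁ * A₁ + 2 * μ₂ * A₂ + 2 * μ₂ * A₃ + 2 * μ₃ * A₂ + 4 * μ₃ * A₃ + 2 * μ₄ * A₄ + 2 * μ₄ * A₆ + 2 * μ₄ * A₇ + 4 * μ₅ * A₅ + 2 * μ₅ * A₆ + 4 * μ₅ * A₇ + 2 * μ₆ * A₄ + 2 * μ₆ * A₅ + 4 * μ₆ * A₆ + 4 * μ₆ * A₇ + 2 * μ₇ * A₄ + 4 * μ₇ * A₅ + 4 * μ₇ * A₆ + 8 * μ₇ * A₇) + (ν₀ * W₀ + 2 * ν₁ * W₁ + 2 * ν₂ * W₂ + 2 * ν₂ * W₃ + 2 * ν₃ * W₂ + 4 * ν₃ * W₃ + 2 * ν₄ * W₄ + 2 * ν₄ * W₆ + 2 * ν₄ * W₇ + 4 * ν₅ * W₅ + 2 * ν₅ * W₆ + 4 * ν₅ * W₇ + 2 * ν₆ * W₄ + 2 * ν₆ * W₅ + 4 * ν₆ * W₆ + 4 * ν₆ * W₇ + 2 * ν₇ * W₄ + 4 * ν₇ * W₅ + 4 * ν₇ * W₆ + 8 * ν₇ * W₇)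 = 1 ∧
      (μ₀ * A₁ + μ₁ * A₀ + μ₂ * A₂ + 2 * μ₂ * A₃ + 2 * μ₃ * A₂ + 2 * μ₃ * A₃ + 2 * μ₄ * A₅ + μ₄ * A₆ + 2 * μ₄ * A₇ + 2 * μ₅ * A₄ + 2 * μ₅ * A₆ + 2 * μ₅ * A₇ + μ₆ * A₄ + 2 * μ₆ * A₅ + 2 * μ₆ * A₆ + 4 * μ₆ * A₇ + 2 * μ₇ * A₄ + 2 * μ₇ * A₅ + 4 * μ₇ * A₆ + 4 * μ₇ * A₇) + (ν₀ * W₁ + ν₁ * W₀ + ν₂ * W₂ + 2 * ν₂ * W₃ + 2 * ν₃ * W₂ + 2 * ν₃ * W₃ + 2 * ν₄ * W₅ + ν₄ * W₆ + 2 * ν₄ * W₇ + 2 * ν₅ * W₄ + 2 * ν₅ * W₆ + 2 * ν₅ * W₇ + ν₆ * W₄ + 2 * ν₆ * W₅ + 2 * ν₆ * W₆ + 4 * ν₆ * W₇ + 2 * ν₇ * W₄ + 2 * ν₇ * W₅ + 4 * ν₇ * W₆ + 4 * ν₇ * W₇) = 0 ∧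
      (μ₀ * A₂ + 2 * μ₁ * A₃ + μ₂ * A₀ + 2 * μ₃ * A₁ + μ₄ * A₄ + 2 * μ₄ * A₆ + 2 * μ₅ * A₅ + 4 * μ₅ * A₇ + 2 * μ₆ * A₄ + 2 * μ₆ * A₆ + 2 * μ₆ * A₇ + 4 * μ₇ * A₅ + 2 * μ₇ * A₆ + 4 * μ₇ * A₇) + (ν₀ * W₂ + 2 * ν₁ * W₃ + ν₂ * W₀ + 2 * ν₃ * W₁ + ν₄ * W₄ + 2 * ν₄ * W₆ + 2 * ν₅ * W₅ + 4 * ν₅ * W₇ + 2 * ν₆ * W₄ + 2 * ν₆ * W₆ + 2 * ν₆ * W₇ + 4 * ν₇ * W₅ + 2 * ν₇ * W₆ + 4 * ν₇ * W₇) = 0 ∧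
      (μ₀ * A₃ + μ₁ * A₂ + μ₂ * A₁ + μ₃ * A₀ + μ₄ * A₅ + 2 * μ₄ * A₇ + μ₅ * A₄ + 2 * μ₅ * A₆ + 2 * μ₆ * A₅ + μ₆ * A₆ + 2 * μ₆ * A₇ + 2 * μ₇ * A₄ + 2 * μ₇ * A₆ + 2 * μ₇ * A₇) + (ν₀ * W₃ + ν₁ * W₂ + ν₂ * W₁ + ν₃ * W₀ + ν₄ * W₅ + 2 * ν₄ * W₇ + ν₅ * W₄ + 2 * ν₅ * W₆ + 2 * ν₆ * W₅ + ν₆ * W₆ + 2 * ν₆ * W₇ + 2 * ν₇ * W₄ + 2 * ν₇ * W₆ + 2 * ν₇ * W₇) = 0 ∧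
      (μ₀ * A₄ + 2 * μ₁ * A₅ + 2 * μ₂ * A₆ + 2 * μ₂ * A₇ + 2 * μ₃ * A₆ + 4 * μ₃ * A₇ + μ₄ * A₀ + 2 * μ₅ * A₁ + 2 * μ₆ * A₂ + 2 * μ₆ * A₃ + 2 * μ₇ * A₂ + 4 * μ₇ * A₃) + (ν₀ * W₄ + 2 * ν₁ * W₅ + 2 * ν₂ * W₆ + 2 * ν₂ * W₇ + 2 * ν₃ * W₆ + 4 * ν₃ * W₇ + ν₄ * W₀ + 2 * ν₅ * W₁ + 2 * ν₆ * W₂ + 2 * ν₆ * W₃ + 2 * ν₇ * W₂ + 4 * ν₇ * W₃) = 0 ∧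
      (μ₀ * A₅ + μ₁ * A₄ + μ₂ * A₆ + 2 * μ₂ * A₇ + 2 * μ₃ * A₆ + 2 * μ₃ * A₇ + μ₄ * A₁ + μ₅ * A₀ + μ₆ * A₂ + 2 * μ₆ * A₃ + 2 * μ₇ * A₂ + 2 * μ₇ * A₃) + (ν₀ * W₅ + ν₁ * W₄ + ν₂ * W₆ + 2 * ν₂ * W₇ + 2 * ν₃ * W₆ + 2 * ν₃ * W₇ + ν₄ * W₁ + ν₅ * W₀ + ν₆ * W₂ + 2 * ν₆ * W₃ + 2 * ν₇ * W₂ + 2 * ν₇ * W₃) = 0 ∧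
      (μ₀ * A₆ + 2 * μ₁ * A₇ + μ₂ * A₄ + 2 * μ₃ * A₅ + μ₄ * A₂ + 2 * μ₅ * A₃ + μ₆ * A₀ + 2 * μ₇ * A₁) + (ν₀ * W₆ + 2 * ν₁ * W₇ + ν₂ * W₄ + 2 * ν₃ * W₅ + ν₄ * W₂ + 2 * ν₅ * W₃ + ν₆ * W₀ + 2 * ν₇ * W₁) = 0 ∧
      (μ₀ * A₇ + μ₁ * A₆ + μ₂ * A₅ + μ₃ * A₄ + μ₄ * A₃ + μ₅ * A₂ + μ₆ * A₁ + μ₇ * A₀) + (ν₀ * W₇ + ν₁ * W₆ + ν₂ * W₅ + ν₃ * W₄ + ν₄ * W₃ + ν₅ * W₂ + ν₆ * W₁ + ν₇ * W₀) = 0)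
    (hq₀ : q₀ ≠ 0)
    (hM2 : q₀ * v₀ = (α₀ * A₀ + 2 * α₁ * A₁ + 2 * α₂ * A₂ + 2 * α₂ * A₃ + 2 * α₃ * A₂ + 4 * α₃ * A₃ + 2 * α₄ * A₄ + 2 * α₄ * A₆ + 2 * α₄ * A₇ + 4 * α₅ * A₅ + 2 * α₅ * A₆ + 4 * α₅ * A₇ + 2 * α₆ * A₄ + 2 * α₆ * A₅ + 4 * α₆ * A₆ + 4 * α₆ * A₇ + 2 * α₇ * A₄ + 4 * α₇ * A₅ + 4 * α₇ * A₆ + 8 * α₇ * A₇) + β₀ * q₀ ^ 2 ∧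
      q₀ * v₁ = (α₀ * A₁ + α₁ * A₀ + α₂ * A₂ + 2 * α₂ * A₃ + 2 * α₃ * A₂ + 2 * α₃ * A₃ + 2 * α₄ * A₅ + α₄ * A₆ + 2 * α₄ * A₇ + 2 * α₅ * A₄ + 2 * α₅ * A₆ + 2 * α₅ * A₇ + α₆ * A₄ + 2 * α₆ * A₅ + 2 * α₆ * A₆ + 4 * α₆ * A₇ + 2 * α₇ * A₄ + 2 * α₇ * A₅ + 4 * α₇ * A₆ + 4 * α₇ * A₇) + β₁ * q₀ ^ 2 ∧
      q₀ * v₂ = (α₀ * A₂ + 2 * α₁ * A₃ + α₂ * A₀ + 2 * α₃ * A₁ + α₄ * A₄ + 2 * α₄ * A₆ + 2 * α₅ * A₅ + 4 * α₅ * A₇ + 2 * α₆ * A₄ + 2 * α₆ * A₆ + 2 * α₆ * A₇ + 4 * α₇ * A₅ + 2 * α₇ * A₆ + 4 * α₇ * A₇) + β₂ * q₀ ^ 2 ∧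
      q₀ * v₃ = (α₀ * A₃ + α₁ * A₂ + α₂ * A₁ + α₃ * A₀ + α₄ * A₅ + 2 * α₄ * A₇ + α₅ * A₄ + 2 * α₅ * A₆ + 2 * α₆ * A₅ + α₆ * A₆ + 2 * α₆ * A₇ + 2 * α₇ * A₄ + 2 * α₇ * A₆ + 2 * α₇ * A₇) + β₃ * q₀ ^ 2 ∧
      q₀ * v₄ = (α₀ * A₄ + 2 * α₁ * A₅ + 2 * α₂ * A₆ + 2 * α₂ * A₇ + 2 * α₃ * A₆ + 4 * α₃ * A₇ + α₄ * A₀ + 2 * α₅ * A₁ + 2 * α₆ * A₂ + 2 * α₆ * A₃ + 2 * α₇ * A₂ + 4 * α₇ * A₃) + β₄ * q₀ ^ 2 ∧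
      q₀ * v₅ = (α₀ * A₅ + α₁ * A₄ + α₂ * A₆ + 2 * α₂ * A₇ + 2 * α₃ * A₆ + 2 * α₃ * A₇ + α₄ * A₁ + α₅ * A₀ + α₆ * A₂ + 2 * α₆ * A₃ + 2 * α₇ * A₂ + 2 * α₇ * A₃) + β₅ * q₀ ^ 2 ∧
      q₀ * v₆ = (α₀ * A₆ + 2 * α₁ * A₇ + α₂ * A₄ + 2 * α₃ * A₅ + α₄ * A₂ + 2 * α₅ * A₃ + α₆ * A₀ + 2 * α₇ * A₁) + β₆ * q₀ ^ 2 ∧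
      q₀ * v₇ = (α₀ * A₇ + α₁ * A₆ + α₂ * A₅ + α₃ * A₄ + α₄ * A₃ + α₅ * A₂ + α₆ * A₁ + α₇ * A₀) + β₇ * q₀ ^ 2)
    (hV : v₀ * v₀ + 2 * v₁ * v₁ + 2 * v₂ * v₂ + 2 * v₂ * v₃ + 2 * v₃ * v₂ + 4 * v₃ * v₃ + 2 * v₄ * v₄ + 2 * v₄ * v₆ + 2 * v₄ * v₇ + 4 * v₅ * v₅ + 2 * v₅ * v₆ + 4 * v₅ * v₇ + 2 * v₆ * v₄ + 2 * v₆ * v₅ + 4 * v₆ * v₆ + 4 * v₆ * v₇ + 2 * v₇ * v₄ + 4 * v₇ * v₅ + 4 * v₇ * v₆ + 8 * v₇ * v₇ = V₀ ∧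
      v₀ * v₁ + v₁ * v₀ + v₂ * v₂ + 2 * v₂ * v₃ + 2 * v₃ * v₂ + 2 * v₃ * v₃ + 2 * v₄ * v₅ + v₄ * v₆ + 2 * v₄ * v₇ + 2 * v₅ * v₄ + 2 * v₅ * v₆ + 2 * v₅ * v₇ + v₆ * v₄ + 2 * v₆ * v₅ + 2 * v₆ * v₆ + 4 * v₆ * v₇ + 2 * v₇ * v₄ + 2 * v₇ * v₅ + 4 * v₇ * v₆ + 4 * v₇ * v₇ = V₁ ∧
      v₀ * v₂ + 2 * v₁ * v₃ + v₂ * v₀ + 2 * v₃ * v₁ + v₄ * v₄ + 2 * v₄ * v₆ + 2 * v₅ * v₅ + 4 * v₅ * v₇ + 2 * v₆ * v₄ + 2 * v₆ * v₆ + 2 * v₆ * v₇ + 4 * v₇ * v₅ + 2 * v₇ * v₆ + 4 * v₇ * v₇ = V₂ ∧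
      v₀ * v₃ + v₁ * v₂ + v₂ * v₁ + v₃ * v₀ + v₄ * v₅ + 2 * v₄ * v₇ + v₅ * v₄ + 2 * v₅ * v₆ + 2 * v₆ * v₅ + v₆ * v₆ + 2 * v₆ * v₇ + 2 * v₇ * v₄ + 2 * v₇ * v₆ + 2 * v₇ * v₇ = V₃ ∧
      v₀ * v₄ + 2 * v₁ * v₅ + 2 * v₂ * v₆ + 2 * v₂ * v₇ + 2 * v₃ * v₆ + 4 * v₃ * v₇ + v₄ * v₀ + 2 * v₅ * v₁ + 2 * v₆ * v₂ + 2 * v₆ * v₃ + 2 * v₇ * v₂ + 4 * v₇ * v₃ = V₄ ∧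
      v₀ * v₅ + v₁ * v₄ + v₂ * v₆ + 2 * v₂ * v₇ + 2 * v₃ * v₆ + 2 * v₃ * v₇ + v₄ * v₁ + v₅ * v₀ + v₆ * v₂ + 2 * v₆ * v₃ + 2 * v₇ * v₂ + 2 * v₇ * v₃ = V₅ ∧
      v₀ * v₆ + 2 * v₁ * v₇ + v₂ * v₄ + 2 * v₃ * v₅ + v₄ * v₂ + 2 * v₅ * v₃ + v₆ * v₀ + 2 * v₇ * v₁ = V₆ ∧
      v₀ * v₇ + v₁ * v₆ + v₂ * v₅ + v₃ * v₄ + v₄ * v₃ + v₅ * v₂ + v₆ * v₁ + v₇ * v₀ = V₇)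
    (hM3 : V₀ = (γ₀ * A₀ + 2 * γ₁ * A₁ + 2 * γ₂ * A₂ + 2 * γ₂ * A₃ + 2 * γ₃ * A₂ + 4 * γ₃ * A₃ + 2 * γ₄ * A₄ + 2 * γ₄ * A₆ + 2 * γ₄ * A₇ + 4 * γ₅ * A₅ + 2 * γ₅ * A₆ + 4 * γ₅ * A₇ + 2 * γ₆ * A₄ + 2 * γ₆ * A₅ + 4 * γ₆ * A₆ + 4 * γ₆ * A₇ + 2 * γ₇ * A₄ + 4 * γ₇ * A₅ + 4 * γ₇ * A₆ + 8 * γ₇ * A₇) + δ₀ * q₀ ^ 2 ∧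
      V₁ = (γ₀ * A₁ + γ₁ * A₀ + γ₂ * A₂ + 2 * γ₂ * A₃ + 2 * γ₃ * A₂ + 2 * γ₃ * A₃ + 2 * γ₄ * A₅ + γ₄ * A₆ + 2 * γ₄ * A₇ + 2 * γ₅ * A₄ + 2 * γ₅ * A₆ + 2 * γ₅ * A₇ + γ₆ * A₄ + 2 * γ₆ * A₅ + 2 * γ₆ * A₆ + 4 * γ₆ * A₇ + 2 * γ₇ * A₄ + 2 * γ₇ * A₅ + 4 * γ₇ * A₆ + 4 * γ₇ * A₇) + δ₁ * q₀ ^ 2 ∧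
      V₂ = (γ₀ * A₂ + 2 * γ₁ * A₃ + γ₂ * A₀ + 2 * γ₃ * A₁ + γ₄ * A₄ + 2 * γ₄ * A₆ + 2 * γ₅ * A₅ + 4 * γ₅ * A₇ + 2 * γ₆ * A₄ + 2 * γ₆ * A₆ + 2 * γ₆ * A₇ + 4 * γ₇ * A₅ + 2 * γ₇ * A₆ + 4 * γ₇ * A₇) + δ₂ * q₀ ^ 2 ∧
      V₃ = (γ₀ * A₃ + γ₁ * A₂ + γ₂ * A₁ + γ₃ * A₀ + γ₄ * A₅ + 2 * γ₄ * A₇ + γ₅ * A₄ + 2 * γ₅ * A₆ + 2 * γ₆ * A₅ + γ₆ * A₆ + 2 * γ₆ * A₇ + 2 * γ₇ * A₄ + 2 * γ₇ * A₆ + 2 * γ₇ * A₇) + δ₃ * q₀ ^ 2 ∧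
      V₄ = (γ₀ * A₄ + 2 * γ₁ * A₅ + 2 * γ₂ * A₆ + 2 * γ₂ * A₇ + 2 * γ₃ * A₆ + 4 * γ₃ * A₇ + γ₄ * A₀ + 2 * γ₅ * A₁ + 2 * γ₆ * A₂ + 2 * γ₆ * A₃ + 2 * γ₇ * A₂ + 4 * γ₇ * A₃) + δ₄ * q₀ ^ 2 ∧
      V₅ = (γ₀ * A₅ + γ₁ * A₄ + γ₂ * A₆ + 2 * γ₂ * A₇ + 2 * γ₃ * A₆ + 2 * γ₃ * A₇ + γ₄ * A₁ + γ₅ * A₀ + γ₆ * A₂ + 2 * γ₆ * A₃ + 2 * γ₇ * A₂ + 2 * γ₇ * A₃) + δ₅ * q₀ ^ 2 ∧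
      V₆ = (γ₀ * A₆ + 2 * γ₁ * A₇ + γ₂ * A₄ + 2 * γ₃ * A₅ + γ₄ * A₂ + 2 * γ₅ * A₃ + γ₆ * A₀ + 2 * γ₇ * A₁) + δ₆ * q₀ ^ 2 ∧
      V₇ = (γ₀ * A₇ + γ₁ * A₆ + γ₂ * A₅ + γ₃ * A₄ + γ₄ * A₃ + γ₅ * A₂ + γ₆ * A₁ + γ₇ * A₀) + δ₇ * q₀ ^ 2)
    (hM4 : A₀ = m₀ * q₀ ^ 2 + (n₀ * (q₀ * v₀) + 2 * n₁ * (q₀ * v₁) + 2 * n₂ * (q₀ * v₂) + 2 * n₂ * (q₀ * v₃) + 2 * n₃ * (q₀ * v₂) + 4 * n₃ * (q₀ * v₃) + 2 * n₄ * (q₀ * v₄) + 2 * n₄ * (q₀ * v₆) + 2 * n₄ * (q₀ * v₇) + 4 * n₅ * (q₀ * v₅) + 2 * n₅ * (q₀ * v₆) + 4 * n₅ * (q₀ * v₇) + 2 * n₆ * (q₀ * v₄) + 2 * n₆ * (q₀ * v₅) + 4 * n₆ * (q₀ * v₆) + 4 * n₆ * (q₀ * v₇) + 2 * n₇ * (q₀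 * v₄) + 4 * n₇ * (q₀ * v₅) + 4 * n₇ * (q₀ * v₆) + 8 * n₇ * (q₀ * v₇)) + (l₀ * V₀ + 2 * l₁ * V₁ + 2 * l₂ * V₂ + 2 * l₂ * V₃ + 2 * l₃ * V₂ + 4 * l₃ * V₃ + 2 * l₄ * V₄ + 2 * l₄ * V₆ + 2 * l₄ * V₇ + 4 * l₅ * V₅ + 2 * l₅ * V₆ + 4 * l₅ * V₇ + 2 * l₆ * V₄ + 2 * l₆ * V₅ + 4 * l₆ * V₆ + 4 * l₆ * V₇ + 2 * l₇ * V₄ + 4 * l₇ * V₅ + 4 * l₇ * V₆ + 8 * l₇ * V₇) ∧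
      A₁ = m₁ * q₀ ^ 2 + (n₀ * (q₀ * v₁) + n₁ * (q₀ * v₀) + n₂ * (q₀ * v₂) + 2 * n₂ * (q₀ * v₃) + 2 * n₃ * (q₀ * v₂) + 2 * n₃ * (q₀ * v₃) + 2 * n₄ * (q₀ * v₅) + n₄ * (q₀ * v₆) + 2 * n₄ * (q₀ * v₇) + 2 * n₅ * (q₀ * v₄) + 2 * n₅ * (q₀ * v₆) + 2 * n₅ * (q₀ * v₇) + n₆ * (q₀ * v₄) + 2 * n₆ * (q₀ * v₅) + 2 * n₆ * (q₀ * v₆) + 4 * n₆ * (q₀ * v₇) + 2 * n₇ * (q₀ * v₄) + 2 * n₇ * (q₀ * v₅) + 4 * n₇ * (q₀ * v₆) + 4 * n₇ * (q₀ * v₇)) + (l₀ * V₁ + l₁ * V₀ + l₂ * V₂ + 2 * l₂ * V₃ + 2 * l₃ * V₂ + 2 * l₃ * V₃ + 2 * l₄ * V₅ + l₄ * V₆ + 2 * l₄ * V₇ + 2 * l₅ * V₄ + 2 * l₅ * V₆ + 2 * l₅ * V₇ + l₆ * V₄ + 2 * l₆ * V₅ + 2 * l₆ * V₆ + 4 *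 l₆ * V₇ + 2 * l₇ * V₄ + 2 * l₇ * V₅ + 4 * l₇ * V₆ + 4 * l₇ * V₇) ∧
      A₂ = m₂ * q₀ ^ 2 + (n₀ * (q₀ * v₂) + 2 * n₁ * (q₀ * v₃) + n₂ * (q₀ * v₀) + 2 * n₃ * (q₀ * v₁) + n₄ * (q₀ * v₄) + 2 * n₄ * (q₀ * v₆) + 2 * n₅ * (q₀ * v₅) + 4 * n₅ * (q₀ * v₇) + 2 * n₆ * (q₀ * v₄) + 2 * n₆ * (q₀ * v₆) + 2 * n₆ * (q₀ * v₇) + 4 * n₇ * (q₀ * v₅) + 2 * n₇ * (q₀ * v₆) + 4 * n₇ * (q₀ * v₇)) + (l₀ * V₂ + 2 * l₁ * V₃ + l₂ * V₀ + 2 * l₃ * V₁ + l₄ * V₄ + 2 * l₄ * V₆ + 2 * l₅ * V₅ + 4 * l₅ * V₇ + 2 * l₆ * V₄ + 2 * l₆ * V₆ + 2 * l₆ * V₇ + 4 * l₇ * V₅ + 2 * l₇ * V₆ + 4 * l₇ * V₇) ∧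
      A₃ = m₃ * q₀ ^ 2 + (n₀ * (q₀ * v₃) + n₁ * (q₀ * v₂) + n₂ * (q₀ * v₁) + n₃ * (q₀ * v₀) + n₄ * (q₀ * v₅) + 2 * n₄ * (q₀ * v₇) + n₅ * (q₀ * v₄) + 2 * n₅ * (q₀ * v₆) + 2 * n₆ * (q₀ * v₅) + n₆ * (q₀ * v₆) + 2 * n₆ * (q₀ * v₇) + 2 * n₇ * (q₀ * v₄) + 2 * n₇ * (q₀ * v₆) + 2 * n₇ * (q₀ * v₇)) + (l₀ * V₃ + l₁ * V₂ + l₂ * V₁ + l₃ * V₀ + l₄ * V₅ + 2 * l₄ * V₇ + l₅ * V₄ + 2 * l₅ * V₆ + 2 * l₆ * V₅ + l₆ * V₆ + 2 * l₆ * V₇ + 2 * l₇ * V₄ + 2 * l₇ * V₆ + 2 * l₇ * V₇) ∧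
      A₄ = m₄ * q₀ ^ 2 + (n₀ * (q₀ * v₄) + 2 * n₁ * (q₀ * v₅) + 2 * n₂ * (q₀ * v₆) + 2 * n₂ * (q₀ * v₇) + 2 * n₃ * (q₀ * v₆) + 4 * n₃ * (q₀ * v₇) + n₄ * (q₀ * v₀) + 2 * n₅ * (q₀ * v₁) + 2 * n₆ * (q₀ * v₂) + 2 * n₆ * (q₀ * v₃) + 2 * n₇ * (q₀ * v₂) + 4 * n₇ * (q₀ * v₃)) + (l₀ * V₄ + 2 * l₁ * V₅ + 2 * l₂ * V₆ + 2 * l₂ * V₇ + 2 * l₃ * V₆ + 4 * l₃ * V₇ + l₄ * V₀ + 2 * l₅ * V₁ + 2 * l₆ * V₂ + 2 * l₆ * V₃ + 2 * l₇ * V₂ + 4 * l₇ * V₃) ∧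
      A₅ = m₅ * q₀ ^ 2 + (n₀ * (q₀ * v₅) + n₁ * (q₀ * v₄) + n₂ * (q₀ * v₆) + 2 * n₂ * (q₀ * v₇) + 2 * n₃ * (q₀ * v₆) + 2 * n₃ * (q₀ * v₇) + n₄ * (q₀ * v₁) + n₅ * (q₀ * v₀) + n₆ * (q₀ * v₂) + 2 * n₆ * (q₀ * v₃) + 2 * n₇ * (q₀ * v₂) + 2 * n₇ * (q₀ * v₃)) + (l₀ * V₅ + l₁ * V₄ + l₂ * V₆ + 2 * l₂ * V₇ + 2 * l₃ * V₆ + 2 * l₃ * V₇ + l₄ * V₁ + l₅ * V₀ + l₆ * V₂ + 2 * l₆ * V₃ + 2 * l₇ * V₂ + 2 * l₇ * V₃) ∧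
      A₆ = m₆ * q₀ ^ 2 + (n₀ * (q₀ * v₆) + 2 * n₁ * (q₀ * v₇) + n₂ * (q₀ * v₄) + 2 * n₃ * (q₀ * v₅) + n₄ * (q₀ * v₂) + 2 * n₅ * (q₀ * v₃) + n₆ * (q₀ * v₀) + 2 * n₇ * (q₀ * v₁)) + (l₀ * V₆ + 2 * l₁ * V₇ + l₂ * V₄ + 2 * l₃ * V₅ + l₄ * V₂ + 2 * l₅ * V₃ + l₆ * V₀ + 2 * l₇ * V₁) ∧
      A₇ = m₇ * q₀ ^ 2 + (n₀ * (q₀ * v₇) + n₁ * (q₀ * v₆) + n₂ * (q₀ * v₅) + n₃ * (q₀ * v₄) + n₄ * (q₀ * v₃) + n₅ * (q₀ * v₂) + n₆ * (q₀ * v₁) + n₇ * (q₀ * v₀)) + (l₀ * V₇ + l₁ * V₆ + l₂ * V₅ + l₃ * V₄ + l₄ * V₃ + l₅ * V₂ + l₆ * V₁ + l₇ * V₀))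
    (hcert : ∀ (e : Fin n → ℕ) (e' : ℕ) (σ : ℤˣ), (∀ i, e i ≤ 1) → e' ≤ 1 → ¬ (e = 0 ∧ e' = 0 ∧ σ = 1) →
      ∃ (q : ℕ) (ψ : 𝓞 K →+* ZMod q) (t r₁ r₂ r₃ : ZMod q), 2 * t = 1 ∧ r₁ ^ 2 = 2 ∧ r₂ ^ 2 = 2 + r₁ ∧ r₃ ^ 2 = 2 + r₂ ∧
        ¬ IsSquare (((σ : ℤ) : ZMod q) *
          (∏ i, (ψ (a₀ i) + ψ (a₁ i) * r₁ + (ψ (a₂ i) + ψ (a₃ i) * r₁) * r₂ + (ψ (a₄ i) + ψ (a₅ i) * r₁ + (ψ (a₆ i) + ψ (a₇ i) * r₁) * r₂) * r₃) ^ e i) *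
          (ψ A₀ + ψ A₁ * r₁ + (ψ A₂ + ψ A₃ * r₁) * r₂ + (ψ A₄ + ψ A₅ * r₁ + (ψ A₆ + ψ A₇ * r₁) * r₂) * r₃) ^ e'))
    :
    ∃ c : ClassGroup (𝓞 (κ.layer 3)), orderOf c = 4 := by
  classical
  haveI : Fact (Nat.Prime 2) := ⟨Nat.prime_two⟩
  -- the layers `K₁ ⊂ K₂ ⊂ K₃` (tree lemmas are stated for `κ.layer (1 + 1)`, `κ.layer (2 + 1)`; bridge once, by `rfl`)
  have h12 : κ.layer 1 ≤ κ.layer 2 := κ.layer_mono one_le_two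
  have h23 : κ.layer 2 ≤ κ.layer 3 := κ.layer_mono (by norm_num)
  have h13 : κ.layer 1 ≤ κ.layer 3 := h12.trans h23
  letI alg12 : Algebra (κ.layer 1) (κ.layer 2) := (IntermediateField.inclusion h12).toRingHom.toAlgebra
  letI alg23 : Algebra (κ.layer 2) (κ.layer 3) := (IntermediateField.inclusion h23).toRingHom.toAlgebra
  letI alg13 : Algebra (κ.layer 1) (κ.layer 3) := (IntermediateField.inclusion h13).toRingHom.toAlgebra
  haveI tow12 : IsScalarTower K (κ.layer 1) (κ.layer 2) :=
    IsScalarTower.of_algebraMap_eq fun x => ((IntermediateField.inclusion h12).commutes x).symm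
  haveI tow23 : IsScalarTower K (κ.layer 2) (κ.layer 3) :=
    IsScalarTower.of_algebraMap_eq fun x => ((IntermediateField.inclusion h23).commutes x).symm
  haveI tow13 : IsScalarTower K (κ.layer 1) (κ.layer 3) :=
    IsScalarTower.of_algebraMap_eq fun x => ((IntermediateField.inclusion h13).commutes x).symm
  haveI tow123 : IsScalarTower (κ.layer 1) (κ.layer 2) (κ.layer 3) :=
    IsScalarTower.of_algebraMap_eq fun x => (IntermediateField.inclusion_inclusion h12 h23 x).symm
  haveI : FiniteDimensional K (κ.layer 1) := κ.finiteDimensional_layer_holds 1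
  haveI : FiniteDimensional K (κ.layer 2) := κ.finiteDimensional_layer_holds 2
  haveI : FiniteDimensional K (κ.layer 3) := κ.finiteDimensional_layer_holds 3
  haveI : NumberField (κ.layer 1) := NumberField.of_module_finite K _
  haveI : NumberField (κ.layer 2) := NumberField.of_module_finite K _
  haveI : NumberField (κ.layer 3) := NumberField.of_module_finite K _
  haveI : IsGalois K (κ.layer 1) := κ.isGalois_layer_holds 1
  haveI : IsGalois K (κ.layer 2) := κ.isGalois_layer_holds 2
  haveI : IsGalois K (κ.layer 3) := κ.isGalois_layer_holds 3
  haveI : IsGalois (κ.layer 1) (κ.layer 2) := IsGalois.tower_top_of_isGalois K _ _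
  haveI : IsGalois (κ.layer 2) (κ.layer 3) := IsGalois.tower_top_of_isGalois K _ _
  haveI : FiniteDimensional (κ.layer 1) (κ.layer 2) := Module.Finite.of_restrictScalars_finite K _ _
  haveI : FiniteDimensional (κ.layer 2) (κ.layer 3) := Module.Finite.of_restrictScalars_finite K _ _
  haveI : IsUnramifiedAtInfinitePlaces K (κ.layer 3) := κ.isUnramifiedAtInfinitePlaces_layer 3
  have hodd : Odd (Module.finrank ℚ K) := Nat.odd_iff.mpr (Nat.two_dvd_ne_zero.mp hK)
  have hdeg1 : Module.finrank K (κ.layer 1) = 2 := by rw [κ.finrank_layer_holds 1, pow_one]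
  have hdeg2 : Module.finrank (κ.layer 1) (κ.layer 2) = 2 := by
    letI : Algebra (κ.layer 1) (κ.layer (1 + 1)) := alg12
    haveI : IsScalarTower K (κ.layer 1) (κ.layer (1 + 1)) := tow12
    exact finrank_layer_one_layer_two κ
  have hdeg3 : Module.finrank (κ.layer 2) (κ.layer 3) = 2 := by
    letI : Algebra (κ.layer 2) (κ.layer (2 + 1)) := alg23
    haveI : IsScalarTower K (κ.layer 2) (κ.layer (2 + 1)) := tow23
    exact finrank_layer_two_layer_three κ
  -- `s₁ ∈ K₁`, `s₂ ∈ K₂`, `s₃ ∈ K₃`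
  obtain ⟨s₁, s₂, s₃, hs₁, hs₂, hs₃, hs₁K, hs₂K, hs₃K⟩ := exists_generators_three_layers hK hd κ hκ
  -- a real place of `K₃` and the rank of `E_{K₃}`
  have hrealK : 0 < NumberField.InfinitePlace.nrRealPlaces K := NumberField.InfinitePlace.nrRealPlaces_pos_of_odd_finrank hodd
  have hreal : 0 < NumberField.InfinitePlace.nrRealPlaces (κ.layer 3) := by
    obtain ⟨⟨w₀, hw₀⟩⟩ := Fintype.card_pos_iff.mp hrealK
    obtain ⟨w, hw⟩ := NumberField.InfinitePlace.comap_surjective (k := K) (K := κ.layer 3) w₀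
    have hu : w.IsUnramified K := NumberField.InfinitePlace.isUnramified K w
    have hw' : w.comap (algebraMap K (κ.layer 3)) = w₀ := hw
    have hwr : w.IsReal := (NumberField.InfinitePlace.isUnramified_iff.mp hu).resolve_right (by
      rw [hw', NumberField.InfinitePlace.not_isComplex_iff_isReal]; exact hw₀)
    exact Fintype.card_pos_iff.mpr ⟨⟨w, hwr⟩⟩
  have hrank : NumberField.Units.rank (κ.layer 3) < n + 1 := by
    have hcard := IsUnramifiedAtInfinitePlaces.card_infinitePlace K (κ.layer 3)
    rw [κ.finrank_layer_holds 3] at hcard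
    have hpos : 0 < Fintype.card (NumberField.InfinitePlace (κ.layer 3)) := Fintype.card_pos
    rw [NumberField.Units.rank]
    norm_num at hcard
    omega
  -- integral generators `S₁, S₂, S₃ ∈ 𝓞 K₃`
  have hs₁int : IsIntegral ℤ s₁ := by
    refine ⟨Polynomial.X ^ 2 - Polynomial.C 2, Polynomial.monic_X_pow_sub_C _ two_ne_zero, ?_⟩
    simp [hs₁]
  have h2int₂ : IsIntegral ℤ (2 : κ.layer 2) := by
    have := isIntegral_algebraMap (R := ℤ) (A := κ.layer 2) (x := (2 : ℤ))
    rwa [map_ofNat] at this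
  have hs₂int : IsIntegral ℤ s₂ := by
    refine IsIntegral.of_pow (n := 2) (by norm_num) ?_
    rw [hs₂, map_add, map_ofNat]
    exact h2int₂.add (map_isIntegral_int _ hs₁int)
  have h2int : IsIntegral ℤ (2 : κ.layer 3) := by
    have := isIntegral_algebraMap (R := ℤ) (A := κ.layer 3) (x := (2 : ℤ))
    rwa [map_ofNat] at this
  have hs₃int : IsIntegral ℤ s₃ := by
    refine IsIntegral.of_pow (n := 2) (by norm_num) ?_
    rw [hs₃, map_add, map_ofNat]
    exact h2int.add (map_isIntegral_int _ hs₂int)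
  obtain ⟨S₁, hS₁val⟩ : ∃ S : 𝓞 (κ.layer 3), algebraMap (𝓞 (κ.layer 3)) (κ.layer 3) S = algebraMap (κ.layer 1) (κ.layer 3) s₁ :=
    ⟨⟨_, map_isIntegral_int (algebraMap (κ.layer 1) (κ.layer 3)) hs₁int⟩, rfl⟩
  obtain ⟨S₂, hS₂val⟩ : ∃ S : 𝓞 (κ.layer 3), algebraMap (𝓞 (κ.layer 3)) (κ.layer 3) S = algebraMap (κ.layer 2) (κ.layer 3) s₂ :=
    ⟨⟨_, map_isIntegral_int (algebraMap (κ.layer 2) (κ.layer 3)) hs₂int⟩, rfl⟩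
  obtain ⟨S₃, hS₃val⟩ : ∃ S : 𝓞 (κ.layer 3), algebraMap (𝓞 (κ.layer 3)) (κ.layer 3) S = s₃ := ⟨⟨_, hs₃int⟩, rfl⟩
  have h12L : ∀ x : κ.layer 1, algebraMap (κ.layer 2) (κ.layer 3) (algebraMap (κ.layer 1) (κ.layer 2) x) = algebraMap (κ.layer 1) (κ.layer 3) x := fun x =>
    (IsScalarTower.algebraMap_apply (κ.layer 1) (κ.layer 2) (κ.layer 3) x).symm
  have hS₁sq : S₁ ^ 2 = 2 := by
    apply RingOfIntegers.coe_injective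
    rw [map_pow, map_ofNat, hS₁val, ← map_pow, hs₁, map_ofNat]
  have hS₂sq : S₂ ^ 2 = 2 + S₁ := by
    apply RingOfIntegers.coe_injective
    rw [map_pow, map_add, map_ofNat, hS₂val, hS₁val, ← map_pow, hs₂, h12L, map_add, map_ofNat]
  have hS₃sq : S₃ ^ 2 = 2 + S₂ := by
    apply RingOfIntegers.coe_injective
    rw [map_pow, map_add, map_ofNat, hS₃val, hS₂val, hs₃, map_add, map_ofNat]
  set f := algebraMap (𝓞 K) (𝓞 (κ.layer 3)) with hf
  have hcoe : ∀ z : 𝓞 K, algebraMap (𝓞 (κ.layer 3)) (κ.layer 3) (f z) = algebraMap K (κ.layer 3) (z : K) := fun z => by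
    rw [hf]
    exact (IsScalarTower.algebraMap_apply (𝓞 K) (𝓞 (κ.layer 3)) (κ.layer 3) z).symm.trans
      (IsScalarTower.algebraMap_apply (𝓞 K) K (κ.layer 3) z)
  have hcoord : ∀ x₀ x₁ x₂ x₃ x₄ x₅ x₆ x₇ : 𝓞 K,
      ((f x₀ + f x₁ * S₁ + (f x₂ + f x₃ * S₁) * S₂ + (f x₄ + f x₅ * S₁ + (f x₆ + f x₇ * S₁) * S₂) * S₃ : 𝓞 (κ.layer 3)) : κ.layer 3) =
      algebraMap K (κ.layer 3) (x₀ : K) + algebraMap K (κ.layer 3) (x₁ : K) * algebraMap (κ.layer 1) (κ.layer 3) s₁ +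
      (algebraMap K (κ.layer 3) (x₂ : K) + algebraMap K (κ.layer 3) (x₃ : K) * algebraMap (κ.layer 1) (κ.layer 3) s₁) * algebraMap (κ.layer 2) (κ.layer 3) s₂ +
      (algebraMap K (κ.layer 3) (x₄ : K) + algebraMap K (κ.layer 3) (x₅ : K) * algebraMap (κ.layer 1) (κ.layer 3) s₁ +
        (algebraMap K (κ.layer 3) (x₆ : K) + algebraMap K (κ.layer 3) (x₇ : K) * algebraMap (κ.layer 1) (κ.layer 3) s₁) * algebraMap (κ.layer 2) (κ.layer 3) s₂) * s₃ := by
    intro x₀ x₁ x₂ x₃ x₄ x₅ x₆ x₇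
    rw [RingOfIntegers.coe_eq_algebraMap]
    simp only [map_add, map_mul, hcoe, hS₁val, hS₂val, hS₃val]
  -- units, `w`, `w*`, `b = q₀`, `v` and the two ideal identities (pure algebra, §0)
  set u : Fin n → (𝓞 (κ.layer 3))ˣ := fun i => Units.mkOfMulEqOne _ _ (tower3_mul_eq_one_of_coords f hS₁sq hS₂sq hS₃sq (hu i)) with hudef
  obtain ⟨w, hw⟩ : ∃ w : 𝓞 (κ.layer 3), w = f A₀ + f A₁ * S₁ + (f A₂ + f A₃ * S₁) * S₂ + (f A₄ + f A₅ * S₁ + (f A₆ + f A₇ * S₁) * S₂) * S₃ := ⟨_, rfl⟩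
  obtain ⟨ws, hws'⟩ : ∃ ws : 𝓞 (κ.layer 3), ws = f W₀ + f W₁ * S₁ + (f W₂ + f W₃ * S₁) * S₂ + (f W₄ + f W₅ * S₁ + (f W₆ + f W₇ * S₁) * S₂) * S₃ := ⟨_, rfl⟩
  obtain ⟨b, hb⟩ : ∃ b : 𝓞 (κ.layer 3), b = f q₀ := ⟨_, rfl⟩
  obtain ⟨v, hv⟩ : ∃ v : 𝓞 (κ.layer 3), v = f v₀ + f v₁ * S₁ + (f v₂ + f v₃ * S₁) * S₂ + (f v₄ + f v₅ * S₁ + (f v₆ + f v₇ * S₁) * S₂) * S₃ := ⟨_, rfl⟩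
  have hb0 : b ≠ 0 := by
    intro h
    apply hq₀
    have h' : algebraMap (𝓞 (κ.layer 3)) (κ.layer 3) b = 0 := by rw [h, map_zero]
    rw [hb, hcoe, map_eq_zero_iff _ (algebraMap K (κ.layer 3)).injective] at h'
    exact RingOfIntegers.coe_injective (by simpa using h')
  have hI2 : (Ideal.span {b, v}) ^ 2 = Ideal.span {w, b ^ 2} := by
    rw [hb, hv, hw]
    exact span_pair_sq_eq_span_pair_of_witnesses (tower3_witness_bv f hS₁sq hS₂sq hS₃sq hM2)
      (tower3_witness_vv f hS₁sq hS₂sq hS₃sq hV hM3) (tower3_witness_w f hS₁sq hS₂sq hS₃sq hV hM4)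
  have hI4 : (Ideal.span {w, b ^ 2}) ^ 2 = Ideal.span {w} := by
    rw [hb, hw]
    exact span_pair_sq_eq_span_singleton_of_witnesses (tower3_witness_b4 f hS₁sq hS₂sq hS₃sq hws)
      (tower3_witness_bezout f hS₁sq hS₂sq hS₃sq hbez)
  obtain ⟨c, hc⟩ := exists_orderOf_eq_four_of_tower3OrderFourCert (K := K) hdeg1 hdeg2 hdeg3 hs₁ hs₁K hs₂ hs₂K hs₃ hs₃K hreal hrank u
    a₀ a₁ a₂ a₃ a₄ a₅ a₆ a₇ (A₀ := A₀) (A₁ := A₁) (A₂ := A₂) (A₃ := A₃) (A₄ := A₄) (A₅ := A₅) (A₆ := A₆) (A₇ := A₇) (w := w) (b := b) (v := v)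
    (fun i => by rw [hudef, Units.val_mkOfMulEqOne]; exact hcoord _ _ _ _ _ _ _ _)
    (by rw [hw]; exact hcoord _ _ _ _ _ _ _ _) hb0 hI2 hI4 hcert
  exact ⟨c, hc⟩

/-- ★★★ **`μ₂ = 0`, `λ₂ ≤ 6`, `rank₂ Cl(K_m) ≤ 6 ∀ m` from the layer-three tower certificate**, for `K` with moreover `2 ∤ h_K` and `e₁ ≤ 1`: the class of
order `4` in `Cl(K_3)` is the input of att-p3 g47's elementary-layer door `classicalMuVanishes_two_of_orderOf_eq_four_of_not_dvd_discr` at `k = 3`.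
[cite: Washington1997, §13.3 Lemmas 13.15, 13.18] [cite: NeukirchANT1999, Ch. I §7 Thm. (7.4), Ch. I §3] [cite: Cohen1993, §6.5] -/
theorem classicalMuVanishes_two_of_layer_three_tower3Cert (hK : ¬ 2 ∣ Module.finrank ℚ K) (hd : ¬ (2 : ℤ) ∣ NumberField.discr K)
    (hh : ¬ 2 ∣ classNumber K) {n : ℕ} (hPl : 8 * Fintype.card (NumberField.InfinitePlace K) ≤ n + 1)
    (κ : ZpExtension K 2) (hκ : κ.IsCyclotomic) (h1 : classNumberPExp κ 1 ≤ 1)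
    (a₀ a₁ a₂ a₃ a₄ a₅ a₆ a₇ c₀ c₁ c₂ c₃ c₄ c₅ c₆ c₇ : Fin n → 𝓞 K)
    {A₀ A₁ A₂ A₃ A₄ A₅ A₆ A₇ W₀ W₁ W₂ W₃ W₄ W₅ W₆ W₇ μ₀ μ₁ μ₂ μ₃ μ₄ μ₅ μ₆ μ₇ ν₀ ν₁ ν₂ ν₃ ν₄ ν₅ ν₆ ν₇ q₀ v₀ v₁ v₂ v₃ v₄ v₅ v₆ v₇ α₀ α₁ α₂ α₃ α₄ α₅ α₆ α₇ β₀ β₁ β₂ β₃ β₄ β₅ β₆ β₇ γ₀ γ₁ γ₂ γ₃ γ₄ γ₅ γ₆ γ₇ δ₀ δ₁ δ₂ δ₃ δ₄ δ₅ δ₆ δ₇ m₀ m₁ m₂ m₃ m₄ m₅ m₆ m₇ n₀ n₁ n₂ n₃ n₄ n₅ n₆ n₇ l₀ l₁ l₂ l₃ l₄ l₅ l₆ l₇ V₀ V₁ V₂ V₃ V₄ V₅ V₆ V₇ : 𝓞 K}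
    (hu : ∀ i, a₀ i * c₀ i + 2 * a₁ i * c₁ i + 2 * a₂ i * c₂ i + 2 * a₂ i * c₃ i + 2 * a₃ i * c₂ i + 4 * a₃ i * c₃ i + 2 * a₄ i * c₄ i + 2 * a₄ i * c₆ i + 2 * a₄ i * c₇ i + 4 * a₅ i * c₅ i + 2 * a₅ i * c₆ i + 4 * a₅ i * c₇ i + 2 * a₆ i * c₄ i + 2 * a₆ i * c₅ i + 4 * a₆ i * c₆ i + 4 * a₆ i * c₇ i + 2 * a₇ i * c₄ i + 4 * a₇ i * c₅ i + 4 * a₇ i * c₆ i + 8 * a₇ i * c₇ i = 1 ∧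
      a₀ i * c₁ i + a₁ i * c₀ i + a₂ i * c₂ i + 2 * a₂ i * c₃ i + 2 * a₃ i * c₂ i + 2 * a₃ i * c₃ i + 2 * a₄ i * c₅ i + a₄ i * c₆ i + 2 * a₄ i * c₇ i + 2 * a₅ i * c₄ i + 2 * a₅ i * c₆ i + 2 * a₅ i * c₇ i + a₆ i * c₄ i + 2 * a₆ i * c₅ i + 2 * a₆ i * c₆ i + 4 * a₆ i * c₇ i + 2 * a₇ i * c₄ i + 2 * a₇ i * c₅ i + 4 * a₇ i * c₆ i + 4 * a₇ i * c₇ i = 0 ∧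
      a₀ i * c₂ i + 2 * a₁ i * c₃ i + a₂ i * c₀ i + 2 * a₃ i * c₁ i + a₄ i * c₄ i + 2 * a₄ i * c₆ i + 2 * a₅ i * c₅ i + 4 * a₅ i * c₇ i + 2 * a₆ i * c₄ i + 2 * a₆ i * c₆ i + 2 * a₆ i * c₇ i + 4 * a₇ i * c₅ i + 2 * a₇ i * c₆ i + 4 * a₇ i * c₇ i = 0 ∧
      a₀ i * c₃ i + a₁ i * c₂ i + a₂ i * c₁ i + a₃ i * c₀ i + a₄ i * c₅ i + 2 * a₄ i * c₇ i + a₅ i * c₄ i + 2 * a₅ i * c₆ i + 2 * a₆ i * c₅ i + a₆ i * c₆ i + 2 * a₆ i * c₇ i + 2 * a₇ i * c₄ i + 2 * a₇ i * c₆ i + 2 * a₇ i * c₇ i = 0 ∧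
      a₀ i * c₄ i + 2 * a₁ i * c₅ i + 2 * a₂ i * c₆ i + 2 * a₂ i * c₇ i + 2 * a₃ i * c₆ i + 4 * a₃ i * c₇ i + a₄ i * c₀ i + 2 * a₅ i * c₁ i + 2 * a₆ i * c₂ i + 2 * a₆ i * c₃ i + 2 * a₇ i * c₂ i + 4 * a₇ i * c₃ i = 0 ∧
      a₀ i * c₅ i + a₁ i * c₄ i + a₂ i * c₆ i + 2 * a₂ i * c₇ i + 2 * a₃ i * c₆ i + 2 * a₃ i * c₇ i + a₄ i * c₁ i + a₅ i * c₀ i + a₆ i * c₂ i + 2 * a₆ i * c₃ i + 2 * a₇ i * c₂ i + 2 * a₇ i * c₃ i = 0 ∧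
      a₀ i * c₆ i + 2 * a₁ i * c₇ i + a₂ i * c₄ i + 2 * a₃ i * c₅ i + a₄ i * c₂ i + 2 * a₅ i * c₃ i + a₆ i * c₀ i + 2 * a₇ i * c₁ i = 0 ∧
      a₀ i * c₇ i + a₁ i * c₆ i + a₂ i * c₅ i + a₃ i * c₄ i + a₄ i * c₃ i + a₅ i * c₂ i + a₆ i * c₁ i + a₇ i * c₀ i = 0)
    (hws : q₀ ^ 4 = A₀ * W₀ + 2 * A₁ * W₁ + 2 * A₂ * W₂ + 2 * A₂ * W₃ + 2 * A₃ * W₂ + 4 * A₃ * W₃ + 2 * A₄ * W₄ + 2 * A₄ * W₆ + 2 * A₄ * W₇ + 4 * A₅ * W₅ + 2 * A₅ * W₆ + 4 * A₅ * W₇ + 2 * A₆ * W₄ + 2 * A₆ * W₅ + 4 * A₆ * W₆ + 4 * A₆ * W₇ + 2 * A₇ * W₄ + 4 * A₇ * W₅ + 4 * A₇ * W₆ + 8 * A₇ * W₇ ∧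
      (0 : 𝓞 K) = A₀ * W₁ + A₁ * W₀ + A₂ * W₂ + 2 * A₂ * W₃ + 2 * A₃ * W₂ + 2 * A₃ * W₃ + 2 * A₄ * W₅ + A₄ * W₆ + 2 * A₄ * W₇ + 2 * A₅ * W₄ + 2 * A₅ * W₆ + 2 * A₅ * W₇ + A₆ * W₄ + 2 * A₆ * W₅ + 2 * A₆ * W₆ + 4 * A₆ * W₇ + 2 * A₇ * W₄ + 2 * A₇ * W₅ + 4 * A₇ * W₆ + 4 * A₇ * W₇ ∧
      (0 : 𝓞 K) = A₀ * W₂ + 2 * A₁ * W₃ + A₂ * W₀ + 2 * A₃ * W₁ + A₄ * W₄ + 2 * A₄ * W₆ + 2 * A₅ * W₅ + 4 * A₅ * W₇ + 2 * A₆ * W₄ + 2 * A₆ * W₆ + 2 * A₆ * W₇ + 4 * A₇ * W₅ + 2 * A₇ * W₆ + 4 * A₇ * W₇ ∧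
      (0 : 𝓞 K) = A₀ * W₃ + A₁ * W₂ + A₂ * W₁ + A₃ * W₀ + A₄ * W₅ + 2 * A₄ * W₇ + A₅ * W₄ + 2 * A₅ * W₆ + 2 * A₆ * W₅ + A₆ * W₆ + 2 * A₆ * W₇ + 2 * A₇ * W₄ + 2 * A₇ * W₆ + 2 * A₇ * W₇ ∧
      (0 : 𝓞 K) = A₀ * W₄ + 2 * A₁ * W₅ + 2 * A₂ * W₆ + 2 * A₂ * W₇ + 2 * A₃ * W₆ + 4 * A₃ * W₇ + A₄ * W₀ + 2 * A₅ * W₁ + 2 * A₆ * W₂ + 2 * A₆ * W₃ + 2 * A₇ * W₂ + 4 * A₇ * W₃ ∧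
      (0 : 𝓞 K) = A₀ * W₅ + A₁ * W₄ + A₂ * W₆ + 2 * A₂ * W₇ + 2 * A₃ * W₆ + 2 * A₃ * W₇ + A₄ * W₁ + A₅ * W₀ + A₆ * W₂ + 2 * A₆ * W₃ + 2 * A₇ * W₂ + 2 * A₇ * W₃ ∧
      (0 : 𝓞 K) = A₀ * W₆ + 2 * A₁ * W₇ + A₂ * W₄ + 2 * A₃ * W₅ + A₄ * W₂ + 2 * A₅ * W₃ + A₆ * W₀ + 2 * A₇ * W₁ ∧
      (0 : 𝓞 K) = A₀ * W₇ + A₁ * W₆ + A₂ * W₅ + A₃ * W₄ + A₄ * W₃ + A₅ * W₂ + A₆ * W₁ + A₇ * W₀)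
    (hbez : (μ₀ * A₀ + 2 * μ₁ * A₁ + 2 * μ₂ * A₂ + 2 * μ₂ * A₃ + 2 * μ₃ * A₂ + 4 * μ₃ * A₃ + 2 * μ₄ * A₄ + 2 * μ₄ * A₆ + 2 * μ₄ * A₇ + 4 * μ₅ * A₅ + 2 * μ₅ * A₆ + 4 * μ₅ * A₇ + 2 * μ₆ * A₄ + 2 * μ₆ * A₅ + 4 * μ₆ * A₆ + 4 * μ₆ * A₇ + 2 * μ₇ * A₄ + 4 * μ₇ * A₅ + 4 * μ₇ * A₆ + 8 * μ₇ * A₇) + (ν₀ * W₀ + 2 * ν₁ * W₁ + 2 * ν₂ * W₂ + 2 * ν₂ * W₃ + 2 * ν₃ * W₂ + 4 * ν₃ * W₃ + 2 * ν₄ * W₄ + 2 * ν₄ * W₆ + 2 * ν₄ * W₇ + 4 * ν₅ * W₅ + 2 * ν₅ * W₆ + 4 * ν₅ * W₇ + 2 * ν₆ * W₄ + 2 * ν₆ * W₅ + 4 * ν₆ * W₆ + 4 * ν₆ * W₇ + 2 * ν₇ * W₄ + 4 * ν₇ * W₅ + 4 * ν₇ * W₆ + 8 * ν₇ * W₇)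 = 1 ∧
      (μ₀ * A₁ + μ₁ * A₀ + μ₂ * A₂ + 2 * μ₂ * A₃ + 2 * μ₃ * A₂ + 2 * μ₃ * A₃ + 2 * μ₄ * A₅ + μ₄ * A₆ + 2 * μ₄ * A₇ + 2 * μ₅ * A₄ + 2 * μ₅ * A₆ + 2 * μ₅ * A₇ + μ₆ * A₄ + 2 * μ₆ * A₅ + 2 * μ₆ * A₆ + 4 * μ₆ * A₇ + 2 * μ₇ * A₄ + 2 * μ₇ * A₅ + 4 * μ₇ * A₆ + 4 * μ₇ * A₇) + (ν₀ * W₁ + ν₁ * W₀ + ν₂ * W₂ + 2 * ν₂ * W₃ + 2 * ν₃ * W₂ + 2 * ν₃ * W₃ + 2 * ν₄ * W₅ + ν₄ * W₆ + 2 * ν₄ * W₇ + 2 * ν₅ * W₄ + 2 * ν₅ * W₆ + 2 * ν₅ * W₇ + ν₆ * W₄ + 2 * ν₆ * W₅ + 2 * ν₆ * W₆ + 4 * ν₆ * W₇ + 2 * ν₇ * W₄ + 2 * ν₇ * W₅ + 4 * ν₇ * W₆ + 4 * ν₇ * W₇) = 0 ∧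
      (μ₀ * A₂ + 2 * μ₁ * A₃ + μ₂ * A₀ + 2 * μ₃ * A₁ + μ₄ * A₄ + 2 * μ₄ * A₆ + 2 * μ₅ * A₅ + 4 * μ₅ * A₇ + 2 * μ₆ * A₄ + 2 * μ₆ * A₆ + 2 * μ₆ * A₇ + 4 * μ₇ * A₅ + 2 * μ₇ * A₆ + 4 * μ₇ * A₇) + (ν₀ * W₂ + 2 * ν₁ * W₃ + ν₂ * W₀ + 2 * ν₃ * W₁ + ν₄ * W₄ + 2 * ν₄ * W₆ + 2 * ν₅ * W₅ + 4 * ν₅ * W₇ + 2 * ν₆ * W₄ + 2 * ν₆ * W₆ + 2 * ν₆ * W₇ + 4 * ν₇ * W₅ + 2 * ν₇ * W₆ + 4 * ν₇ * W₇) = 0 ∧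
      (μ₀ * A₃ + μ₁ * A₂ + μ₂ * A₁ + μ₃ * A₀ + μ₄ * A₅ + 2 * μ₄ * A₇ + μ₅ * A₄ + 2 * μ₅ * A₆ + 2 * μ₆ * A₅ + μ₆ * A₆ + 2 * μ₆ * A₇ + 2 * μ₇ * A₄ + 2 * μ₇ * A₆ + 2 * μ₇ * A₇) + (ν₀ * W₃ + ν₁ * W₂ + ν₂ * W₁ + ν₃ * W₀ + ν₄ * W₅ + 2 * ν₄ * W₇ + ν₅ * W₄ + 2 * ν₅ * W₆ + 2 * ν₆ * W₅ + ν₆ * W₆ + 2 * ν₆ * W₇ + 2 * ν₇ * W₄ + 2 * ν₇ * W₆ + 2 * ν₇ * W₇) = 0 ∧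
      (μ₀ * A₄ + 2 * μ₁ * A₅ + 2 * μ₂ * A₆ + 2 * μ₂ * A₇ + 2 * μ₃ * A₆ + 4 * μ₃ * A₇ + μ₄ * A₀ + 2 * μ₅ * A₁ + 2 * μ₆ * A₂ + 2 * μ₆ * A₃ + 2 * μ₇ * A₂ + 4 * μ₇ * A₃) + (ν₀ * W₄ + 2 * ν₁ * W₅ + 2 * ν₂ * W₆ + 2 * ν₂ * W₇ + 2 * ν₃ * W₆ + 4 * ν₃ * W₇ + ν₄ * W₀ + 2 * ν₅ * W₁ + 2 * ν₆ * W₂ + 2 * ν₆ * W₃ + 2 * ν₇ * W₂ + 4 * ν₇ * W₃) = 0 ∧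
      (μ₀ * A₅ + μ₁ * A₄ + μ₂ * A₆ + 2 * μ₂ * A₇ + 2 * μ₃ * A₆ + 2 * μ₃ * A₇ + μ₄ * A₁ + μ₅ * A₀ + μ₆ * A₂ + 2 * μ₆ * A₃ + 2 * μ₇ * A₂ + 2 * μ₇ * A₃) + (ν₀ * W₅ + ν₁ * W₄ + ν₂ * W₆ + 2 * ν₂ * W₇ + 2 * ν₃ * W₆ + 2 * ν₃ * W₇ + ν₄ * W₁ + ν₅ * W₀ + ν₆ * W₂ + 2 * ν₆ * W₃ + 2 * ν₇ * W₂ + 2 * ν₇ * W₃) = 0 ∧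
      (μ₀ * A₆ + 2 * μ₁ * A₇ + μ₂ * A₄ + 2 * μ₃ * A₅ + μ₄ * A₂ + 2 * μ₅ * A₃ + μ₆ * A₀ + 2 * μ₇ * A₁) + (ν₀ * W₆ + 2 * ν₁ * W₇ + ν₂ * W₄ + 2 * ν₃ * W₅ + ν₄ * W₂ + 2 * ν₅ * W₃ + ν₆ * W₀ + 2 * ν₇ * W₁) = 0 ∧
      (μ₀ * A₇ + μ₁ * A₆ + μ₂ * A₅ + μ₃ * A₄ + μ₄ * A₃ + μ₅ * A₂ + μ₆ * A₁ + μ₇ * A₀) + (ν₀ * W₇ + ν₁ * W₆ + ν₂ * W₅ + ν₃ * W₄ + ν₄ * W₃ + ν₅ * W₂ + ν₆ * W₁ + ν₇ * W₀) = 0)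
    (hq₀ : q₀ ≠ 0)
    (hM2 : q₀ * v₀ = (α₀ * A₀ + 2 * α₁ * A₁ + 2 * α₂ * A₂ + 2 * α₂ * A₃ + 2 * α₃ * A₂ + 4 * α₃ * A₃ + 2 * α₄ * A₄ + 2 * α₄ * A₆ + 2 * α₄ * A₇ + 4 * α₅ * A₅ + 2 * α₅ * A₆ + 4 * α₅ * A₇ + 2 * α₆ * A₄ + 2 * α₆ * A₅ + 4 * α₆ * A₆ + 4 * α₆ * A₇ + 2 * α₇ * A₄ + 4 * α₇ * A₅ + 4 * α₇ * A₆ + 8 * α₇ * A₇) + β₀ * q₀ ^ 2 ∧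
      q₀ * v₁ = (α₀ * A₁ + α₁ * A₀ + α₂ * A₂ + 2 * α₂ * A₃ + 2 * α₃ * A₂ + 2 * α₃ * A₃ + 2 * α₄ * A₅ + α₄ * A₆ + 2 * α₄ * A₇ + 2 * α₅ * A₄ + 2 * α₅ * A₆ + 2 * α₅ * A₇ + α₆ * A₄ + 2 * α₆ * A₅ + 2 * α₆ * A₆ + 4 * α₆ * A₇ + 2 * α₇ * A₄ + 2 * α₇ * A₅ + 4 * α₇ * A₆ + 4 * α₇ * A₇) + β₁ * q₀ ^ 2 ∧
      q₀ * v₂ = (α₀ * A₂ + 2 * α₁ * A₃ + α₂ * A₀ + 2 * α₃ * A₁ + α₄ * A₄ + 2 * α₄ * A₆ + 2 * α₅ * A₅ + 4 * α₅ * A₇ + 2 * α₆ * A₄ + 2 * α₆ * A₆ + 2 * α₆ * A₇ + 4 * α₇ * A₅ + 2 * α₇ * A₆ + 4 * α₇ * A₇) + β₂ * q₀ ^ 2 ∧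
      q₀ * v₃ = (α₀ * A₃ + α₁ * A₂ + α₂ * A₁ + α₃ * A₀ + α₄ * A₅ + 2 * α₄ * A₇ + α₅ * A₄ + 2 * α₅ * A₆ + 2 * α₆ * A₅ + α₆ * A₆ + 2 * α₆ * A₇ + 2 * α₇ * A₄ + 2 * α₇ * A₆ + 2 * α₇ * A₇) + β₃ * q₀ ^ 2 ∧
      q₀ * v₄ = (α₀ * A₄ + 2 * α₁ * A₅ + 2 * α₂ * A₆ + 2 * α₂ * A₇ + 2 * α₃ * A₆ + 4 * α₃ * A₇ + α₄ * A₀ + 2 * α₅ * A₁ + 2 * α₆ * A₂ + 2 * α₆ * A₃ + 2 * α₇ * A₂ + 4 * α₇ * A₃) + β₄ * q₀ ^ 2 ∧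
      q₀ * v₅ = (α₀ * A₅ + α₁ * A₄ + α₂ * A₆ + 2 * α₂ * A₇ + 2 * α₃ * A₆ + 2 * α₃ * A₇ + α₄ * A₁ + α₅ * A₀ + α₆ * A₂ + 2 * α₆ * A₃ + 2 * α₇ * A₂ + 2 * α₇ * A₃) + β₅ * q₀ ^ 2 ∧
      q₀ * v₆ = (α₀ * A₆ + 2 * α₁ * A₇ + α₂ * A₄ + 2 * α₃ * A₅ + α₄ * A₂ + 2 * α₅ * A₃ + α₆ * A₀ + 2 * α₇ * A₁) + β₆ * q₀ ^ 2 ∧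
      q₀ * v₇ = (α₀ * A₇ + α₁ * A₆ + α₂ * A₅ + α₃ * A₄ + α₄ * A₃ + α₅ * A₂ + α₆ * A₁ + α₇ * A₀) + β₇ * q₀ ^ 2)
    (hV : v₀ * v₀ + 2 * v₁ * v₁ + 2 * v₂ * v₂ + 2 * v₂ * v₃ + 2 * v₃ * v₂ + 4 * v₃ * v₃ + 2 * v₄ * v₄ + 2 * v₄ * v₆ + 2 * v₄ * v₇ + 4 * v₅ * v₅ + 2 * v₅ * v₆ + 4 * v₅ * v₇ + 2 * v₆ * v₄ + 2 * v₆ * v₅ + 4 * v₆ * v₆ + 4 * v₆ * v₇ + 2 * v₇ * v₄ + 4 * v₇ * v₅ + 4 * v₇ * v₆ + 8 * v₇ * v₇ = V₀ ∧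
      v₀ * v₁ + v₁ * v₀ + v₂ * v₂ + 2 * v₂ * v₃ + 2 * v₃ * v₂ + 2 * v₃ * v₃ + 2 * v₄ * v₅ + v₄ * v₆ + 2 * v₄ * v₇ + 2 * v₅ * v₄ + 2 * v₅ * v₆ + 2 * v₅ * v₇ + v₆ * v₄ + 2 * v₆ * v₅ + 2 * v₆ * v₆ + 4 * v₆ * v₇ + 2 * v₇ * v₄ + 2 * v₇ * v₅ + 4 * v₇ * v₆ + 4 * v₇ * v₇ = V₁ ∧
      v₀ * v₂ + 2 * v₁ * v₃ + v₂ * v₀ + 2 * v₃ * v₁ + v₄ * v₄ + 2 * v₄ * v₆ + 2 * v₅ * v₅ + 4 * v₅ * v₇ + 2 * v₆ * v₄ + 2 * v₆ * v₆ + 2 * v₆ * v₇ + 4 * v₇ * v₅ + 2 * v₇ * v₆ + 4 * v₇ * v₇ = V₂ ∧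
      v₀ * v₃ + v₁ * v₂ + v₂ * v₁ + v₃ * v₀ + v₄ * v₅ + 2 * v₄ * v₇ + v₅ * v₄ + 2 * v₅ * v₆ + 2 * v₆ * v₅ + v₆ * v₆ + 2 * v₆ * v₇ + 2 * v₇ * v₄ + 2 * v₇ * v₆ + 2 * v₇ * v₇ = V₃ ∧
      v₀ * v₄ + 2 * v₁ * v₅ + 2 * v₂ * v₆ + 2 * v₂ * v₇ + 2 * v₃ * v₆ + 4 * v₃ * v₇ + v₄ * v₀ + 2 * v₅ * v₁ + 2 * v₆ * v₂ + 2 * v₆ * v₃ + 2 * v₇ * v₂ + 4 * v₇ * v₃ = V₄ ∧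
      v₀ * v₅ + v₁ * v₄ + v₂ * v₆ + 2 * v₂ * v₇ + 2 * v₃ * v₆ + 2 * v₃ * v₇ + v₄ * v₁ + v₅ * v₀ + v₆ * v₂ + 2 * v₆ * v₃ + 2 * v₇ * v₂ + 2 * v₇ * v₃ = V₅ ∧
      v₀ * v₆ + 2 * v₁ * v₇ + v₂ * v₄ + 2 * v₃ * v₅ + v₄ * v₂ + 2 * v₅ * v₃ + v₆ * v₀ + 2 * v₇ * v₁ = V₆ ∧
      v₀ * v₇ + v₁ * v₆ + v₂ * v₅ + v₃ * v₄ + v₄ * v₃ + v₅ * v₂ + v₆ * v₁ + v₇ * v₀ = V₇)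
    (hM3 : V₀ = (γ₀ * A₀ + 2 * γ₁ * A₁ + 2 * γ₂ * A₂ + 2 * γ₂ * A₃ + 2 * γ₃ * A₂ + 4 * γ₃ * A₃ + 2 * γ₄ * A₄ + 2 * γ₄ * A₆ + 2 * γ₄ * A₇ + 4 * γ₅ * A₅ + 2 * γ₅ * A₆ + 4 * γ₅ * A₇ + 2 * γ₆ * A₄ + 2 * γ₆ * A₅ + 4 * γ₆ * A₆ + 4 * γ₆ * A₇ + 2 * γ₇ * A₄ + 4 * γ₇ * A₅ + 4 * γ₇ * A₆ + 8 * γ₇ * A₇) + δ₀ * q₀ ^ 2 ∧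
      V₁ = (γ₀ * A₁ + γ₁ * A₀ + γ₂ * A₂ + 2 * γ₂ * A₃ + 2 * γ₃ * A₂ + 2 * γ₃ * A₃ + 2 * γ₄ * A₅ + γ₄ * A₆ + 2 * γ₄ * A₇ + 2 * γ₅ * A₄ + 2 * γ₅ * A₆ + 2 * γ₅ * A₇ + γ₆ * A₄ + 2 * γ₆ * A₅ + 2 * γ₆ * A₆ + 4 * γ₆ * A₇ + 2 * γ₇ * A₄ + 2 * γ₇ * A₅ + 4 * γ₇ * A₆ + 4 * γ₇ * A₇) + δ₁ * q₀ ^ 2 ∧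
      V₂ = (γ₀ * A₂ + 2 * γ₁ * A₃ + γ₂ * A₀ + 2 * γ₃ * A₁ + γ₄ * A₄ + 2 * γ₄ * A₆ + 2 * γ₅ * A₅ + 4 * γ₅ * A₇ + 2 * γ₆ * A₄ + 2 * γ₆ * A₆ + 2 * γ₆ * A₇ + 4 * γ₇ * A₅ + 2 * γ₇ * A₆ + 4 * γ₇ * A₇) + δ₂ * q₀ ^ 2 ∧
      V₃ = (γ₀ * A₃ + γ₁ * A₂ + γ₂ * A₁ + γ₃ * A₀ + γ₄ * A₅ + 2 * γ₄ * A₇ + γ₅ * A₄ + 2 * γ₅ * A₆ + 2 * γ₆ * A₅ + γ₆ * A₆ + 2 * γ₆ * A₇ + 2 * γ₇ * A₄ + 2 * γ₇ * A₆ + 2 * γ₇ * A₇) + δ₃ * q₀ ^ 2 ∧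
      V₄ = (γ₀ * A₄ + 2 * γ₁ * A₅ + 2 * γ₂ * A₆ + 2 * γ₂ * A₇ + 2 * γ₃ * A₆ + 4 * γ₃ * A₇ + γ₄ * A₀ + 2 * γ₅ * A₁ + 2 * γ₆ * A₂ + 2 * γ₆ * A₃ + 2 * γ₇ * A₂ + 4 * γ₇ * A₃) + δ₄ * q₀ ^ 2 ∧
      V₅ = (γ₀ * A₅ + γ₁ * A₄ + γ₂ * A₆ + 2 * γ₂ * A₇ + 2 * γ₃ * A₆ + 2 * γ₃ * A₇ + γ₄ * A₁ + γ₅ * A₀ + γ₆ * A₂ + 2 * γ₆ * A₃ + 2 * γ₇ * A₂ + 2 * γ₇ * A₃) + δ₅ * q₀ ^ 2 ∧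
      V₆ = (γ₀ * A₆ + 2 * γ₁ * A₇ + γ₂ * A₄ + 2 * γ₃ * A₅ + γ₄ * A₂ + 2 * γ₅ * A₃ + γ₆ * A₀ + 2 * γ₇ * A₁) + δ₆ * q₀ ^ 2 ∧
      V₇ = (γ₀ * A₇ + γ₁ * A₆ + γ₂ * A₅ + γ₃ * A₄ + γ₄ * A₃ + γ₅ * A₂ + γ₆ * A₁ + γ₇ * A₀) + δ₇ * q₀ ^ 2)
    (hM4 : A₀ = m₀ * q₀ ^ 2 + (n₀ * (q₀ * v₀) + 2 * n₁ * (q₀ * v₁) + 2 * n₂ * (q₀ * v₂) + 2 * n₂ * (q₀ * v₃) + 2 * n₃ * (q₀ * v₂) + 4 * n₃ * (q₀ * v₃) + 2 * n₄ * (q₀ * v₄) + 2 * n₄ * (q₀ * v₆) + 2 * n₄ * (q₀ * v₇) + 4 * n₅ * (q₀ * v₅) + 2 * n₅ * (q₀ * v₆) + 4 * n₅ * (q₀ * v₇) + 2 * n₆ * (q₀ * v₄) + 2 * n₆ * (q₀ * v₅) + 4 * n₆ * (q₀ * v₆) + 4 * n₆ * (q₀ * v₇) + 2 * n₇ * (q₀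 * v₄) + 4 * n₇ * (q₀ * v₅) + 4 * n₇ * (q₀ * v₆) + 8 * n₇ * (q₀ * v₇)) + (l₀ * V₀ + 2 * l₁ * V₁ + 2 * l₂ * V₂ + 2 * l₂ * V₃ + 2 * l₃ * V₂ + 4 * l₃ * V₃ + 2 * l₄ * V₄ + 2 * l₄ * V₆ + 2 * l₄ * V₇ + 4 * l₅ * V₅ + 2 * l₅ * V₆ + 4 * l₅ * V₇ + 2 * l₆ * V₄ + 2 * l₆ * V₅ + 4 * l₆ * V₆ + 4 * l₆ * V₇ + 2 * l₇ * V₄ + 4 * l₇ * V₅ + 4 * l₇ * V₆ + 8 * l₇ * V₇) ∧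
      A₁ = m₁ * q₀ ^ 2 + (n₀ * (q₀ * v₁) + n₁ * (q₀ * v₀) + n₂ * (q₀ * v₂) + 2 * n₂ * (q₀ * v₃) + 2 * n₃ * (q₀ * v₂) + 2 * n₃ * (q₀ * v₃) + 2 * n₄ * (q₀ * v₅) + n₄ * (q₀ * v₆) + 2 * n₄ * (q₀ * v₇) + 2 * n₅ * (q₀ * v₄) + 2 * n₅ * (q₀ * v₆) + 2 * n₅ * (q₀ * v₇) + n₆ * (q₀ * v₄) + 2 * n₆ * (q₀ * v₅) + 2 * n₆ * (q₀ * v₆) + 4 * n₆ * (q₀ * v₇) + 2 * n₇ * (q₀ * v₄) + 2 * n₇ * (q₀ * v₅) + 4 * n₇ * (q₀ * v₆) + 4 * n₇ * (q₀ * v₇)) + (l₀ * V₁ + l₁ * V₀ + l₂ * V₂ + 2 * l₂ * V₃ + 2 * l₃ * V₂ + 2 * l₃ * V₃ + 2 * l₄ * V₅ + l₄ * V₆ + 2 * l₄ * V₇ + 2 * l₅ * V₄ + 2 * l₅ * V₆ + 2 * l₅ * V₇ + l₆ * V₄ + 2 * l₆ * V₅ + 2 * l₆ * V₆ + 4 *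 l₆ * V₇ + 2 * l₇ * V₄ + 2 * l₇ * V₅ + 4 * l₇ * V₆ + 4 * l₇ * V₇) ∧
      A₂ = m₂ * q₀ ^ 2 + (n₀ * (q₀ * v₂) + 2 * n₁ * (q₀ * v₃) + n₂ * (q₀ * v₀) + 2 * n₃ * (q₀ * v₁) + n₄ * (q₀ * v₄) + 2 * n₄ * (q₀ * v₆) + 2 * n₅ * (q₀ * v₅) + 4 * n₅ * (q₀ * v₇) + 2 * n₆ * (q₀ * v₄) + 2 * n₆ * (q₀ * v₆) + 2 * n₆ * (q₀ * v₇) + 4 * n₇ * (q₀ * v₅) + 2 * n₇ * (q₀ * v₆) + 4 * n₇ * (q₀ * v₇)) + (l₀ * V₂ + 2 * l₁ * V₃ + l₂ * V₀ + 2 * l₃ * V₁ + l₄ * V₄ + 2 * l₄ * V₆ + 2 * l₅ * V₅ + 4 * l₅ * V₇ + 2 * l₆ * V₄ + 2 * l₆ * V₆ + 2 * l₆ * V₇ + 4 * l₇ * V₅ + 2 * l₇ * V₆ + 4 * l₇ * V₇) ∧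
      A₃ = m₃ * q₀ ^ 2 + (n₀ * (q₀ * v₃) + n₁ * (q₀ * v₂) + n₂ * (q₀ * v₁) + n₃ * (q₀ * v₀) + n₄ * (q₀ * v₅) + 2 * n₄ * (q₀ * v₇) + n₅ * (q₀ * v₄) + 2 * n₅ * (q₀ * v₆) + 2 * n₆ * (q₀ * v₅) + n₆ * (q₀ * v₆) + 2 * n₆ * (q₀ * v₇) + 2 * n₇ * (q₀ * v₄) + 2 * n₇ * (q₀ * v₆) + 2 * n₇ * (q₀ * v₇)) + (l₀ * V₃ + l₁ * V₂ + l₂ * V₁ + l₃ * V₀ + l₄ * V₅ + 2 * l₄ * V₇ + l₅ * V₄ + 2 * l₅ * V₆ + 2 * l₆ * V₅ + l₆ * V₆ + 2 * l₆ * V₇ + 2 * l₇ * V₄ + 2 * l₇ * V₆ + 2 * l₇ * V₇) ∧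
      A₄ = m₄ * q₀ ^ 2 + (n₀ * (q₀ * v₄) + 2 * n₁ * (q₀ * v₅) + 2 * n₂ * (q₀ * v₆) + 2 * n₂ * (q₀ * v₇) + 2 * n₃ * (q₀ * v₆) + 4 * n₃ * (q₀ * v₇) + n₄ * (q₀ * v₀) + 2 * n₅ * (q₀ * v₁) + 2 * n₆ * (q₀ * v₂) + 2 * n₆ * (q₀ * v₃) + 2 * n₇ * (q₀ * v₂) + 4 * n₇ * (q₀ * v₃)) + (l₀ * V₄ + 2 * l₁ * V₅ + 2 * l₂ * V₆ + 2 * l₂ * V₇ + 2 * l₃ * V₆ + 4 * l₃ * V₇ + l₄ * V₀ + 2 * l₅ * V₁ + 2 * l₆ * V₂ + 2 * l₆ * V₃ + 2 * l₇ * V₂ + 4 * l₇ * V₃) ∧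
      A₅ = m₅ * q₀ ^ 2 + (n₀ * (q₀ * v₅) + n₁ * (q₀ * v₄) + n₂ * (q₀ * v₆) + 2 * n₂ * (q₀ * v₇) + 2 * n₃ * (q₀ * v₆) + 2 * n₃ * (q₀ * v₇) + n₄ * (q₀ * v₁) + n₅ * (q₀ * v₀) + n₆ * (q₀ * v₂) + 2 * n₆ * (q₀ * v₃) + 2 * n₇ * (q₀ * v₂) + 2 * n₇ * (q₀ * v₃)) + (l₀ * V₅ + l₁ * V₄ + l₂ * V₆ + 2 * l₂ * V₇ + 2 * l₃ * V₆ + 2 * l₃ * V₇ + l₄ * V₁ + l₅ * V₀ + l₆ * V₂ + 2 * l₆ * V₃ + 2 * l₇ * V₂ + 2 * l₇ * V₃) ∧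
      A₆ = m₆ * q₀ ^ 2 + (n₀ * (q₀ * v₆) + 2 * n₁ * (q₀ * v₇) + n₂ * (q₀ * v₄) + 2 * n₃ * (q₀ * v₅) + n₄ * (q₀ * v₂) + 2 * n₅ * (q₀ * v₃) + n₆ * (q₀ * v₀) + 2 * n₇ * (q₀ * v₁)) + (l₀ * V₆ + 2 * l₁ * V₇ + l₂ * V₄ + 2 * l₃ * V₅ + l₄ * V₂ + 2 * l₅ * V₃ + l₆ * V₀ + 2 * l₇ * V₁) ∧
      A₇ = m₇ * q₀ ^ 2 + (n₀ * (q₀ * v₇) + n₁ * (q₀ * v₆) + n₂ * (q₀ * v₅) + n₃ * (q₀ * v₄) + n₄ * (q₀ * v₃) + n₅ * (q₀ * v₂) + n₆ * (q₀ * v₁) + n₇ * (q₀ * v₀)) + (l₀ * V₇ + l₁ * V₆ + l₂ * V₅ + l₃ * V₄ + l₄ * V₃ + l₅ * V₂ + l₆ * V₁ + l₇ * V₀))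
    (hcert : ∀ (e : Fin n → ℕ) (e' : ℕ) (σ : ℤˣ), (∀ i, e i ≤ 1) → e' ≤ 1 → ¬ (e = 0 ∧ e' = 0 ∧ σ = 1) →
      ∃ (q : ℕ) (ψ : 𝓞 K →+* ZMod q) (t r₁ r₂ r₃ : ZMod q), 2 * t = 1 ∧ r₁ ^ 2 = 2 ∧ r₂ ^ 2 = 2 + r₁ ∧ r₃ ^ 2 = 2 + r₂ ∧
        ¬ IsSquare (((σ : ℤ) : ZMod q) *
          (∏ i, (ψ (a₀ i) + ψ (a₁ i) * r₁ + (ψ (a₂ i) + ψ (a₃ i) * r₁) * r₂ + (ψ (a₄ i) + ψ (a₅ i) * r₁ + (ψ (a₆ i) + ψ (a₇ i) * r₁) * r₂) * r₃) ^ e i) *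
          (ψ A₀ + ψ A₁ * r₁ + (ψ A₂ + ψ A₃ * r₁) * r₂ + (ψ A₄ + ψ A₅ * r₁ + (ψ A₆ + ψ A₇ * r₁) * r₂) * r₃) ^ e'))
    :
    (∀ m, classGroupPRank κ m ≤ 6) ∧ ClassicalMuVanishes κ ∧ classicalLambda κ ≤ 6 := by
  obtain ⟨c, hc⟩ := exists_orderOf_eq_four_layer_three_of_tower3Cert hK hd hPl κ hκ
    a₀ a₁ a₂ a₃ a₄ a₅ a₆ a₇ c₀ c₁ c₂ c₃ c₄ c₅ c₆ c₇ hu hws hbez hq₀ hM2 hV hM3 hM4 hcert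
  have h := classicalMuVanishes_two_of_orderOf_eq_four_of_not_dvd_discr hK hd hh κ hκ h1 (k := 3) hc
  norm_num at h
  exact h

end Literature.NumberTheory.IwasawaTheory

end
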